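/-
HarnessLib.Audit.Tribunal — D-0034 "tribunal-as-fitness": the KERNEL half (t0) of the pre-birth tribunal, `#h21_tribunal`.
docs/architecture/tribunal.md §5 (clause semantics) + §14 (this pre-read); calibration docs/m5/RETRO-TRIBUNAL-2026-08-17.md §6–7.
Imported by NOTHING in the tree (like `HarnessLib.Audit.CruxProbe` / `.Check`): the CLI / gate appends `import HarnessLib.Audit.Tribunal`
+ one `#h21_tribunal …` command to a scratch copy of the route file (which brings Mathlib and the strong-hypothesis library files).
Imports Lean + Tags + TribunalTags + CruxProbe + CarrierProbe only (no Mathlib: tactics are parsed at run time and reported `unavailable`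
where they do not exist). Deterministic: fixed tactic order, heartbeat cap per attempt, wall budgets from options, no randomness. It never throws.
Fixture + farm test: harness/gate/tests/h21_audit/F31_tribunal.lean, harness/gate/tests/test_h21_tribunal.sh.
-/
import Lean
import HarnessLib.Audit.Tags
import HarnessLib.Audit.TribunalTags
import HarnessLib.Audit.CruxProbe
import HarnessLib.Audit.CarrierProbe

/-!
# `#h21_tribunal "route-id" [summit := S] [cruxes := [C₁, …]] [witness := W] [s_case := X] [residual := [R₁, …]] [mode := forward|topdown] [floor := F] [tier := quick|full] [method_family := "tok tok"] [nonce := "hex"]`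

Inputs. The `@[closes "route-id"]` theorem visible from the file gives the SUMMIT `S` (its conclusion; `summit :=` overrides) and the
LOAD-BEARING CRUXES (the head constants of its `Prop` binders that are `@[route_item "route-id"]` decls, in binder order); `cruxes := […]`
supplements them (and replaces the closes theorem when there is none — then `summit :=` is required).

Clauses (per load-bearing crux `C` unless noted; every tactic attempt runs through `CruxProbe.tryTacticOn` under a heartbeat cap, wall
deadlines are checked between attempts, proofs that use a `@[closes]` theorem never count):
* t1b IMPLIES-SUMMIT `C → S` (CruxProbe.summitTactics; no `exact?` in tier quick) ⇒ `rule_d_premise` (rule (d)'s premise, NOT summit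
  strength by itself); and `S → C` (no library search, plus the specialisation tactics `spTactics`) ⇒ `s_implies_c` (feeds t1r / forward).
* t1a LANDED-CONVERSE SCAN over the project theorems visible from the file whose statement mentions `C`: `C ↔ S` (`iff-summit`),
  `… → S → … → C` (`summit-implies-crux`) — DECISIVE when axiom-clean (rule (b)); informational kinds `iff-hypothesis:H`, `iff-other:X`,
  `hypothesis-implies-crux:H` (a landed `H → C` for a registered strong hypothesis: handed to t1c as its first tactic),
  `crux-implies-summit-landed|conditional`.
* t1c STRONG HYPOTHESIS: for every `@[strong_hypothesis]` decl `H` whose key covers the summit key: goal `H → C` (and `H⁎ → C` with the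
  definiens) by a fixed cheap portfolio (+ `exact?` in tier full) ⇒ fired; DECISIVE (rule (a)) iff a `@[summit_bridge]` for `H` is in
  scope (landed theorem or printed `def … : Prop`).
* t1r CONJUNCT RESIDUE: joint := every load-bearing crux has `s_implies_c` ∧ there are ≥ 2; joint ∧ no `residual :=` ⇒ `joint-unassigned`
  (summit strength); joint ∧ residual declared ⇒ `joint-declared`; else `not-joint`.
* t3k WITNESS (route level): `witness := W` a clean theorem ⇒ present (+ whether its statement mentions the crux or its namespace);
  `s_case := X` (the S-restricted case): a theorem, or a Prop def a cheap portfolio closes ⇒ found ⇒ flag `T3-inside-known-regime`.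
* t-carrier CARRIER VACUITY (per crux, `CarrierProbe.probeStatementCarriers`): every DATA binder of the crux statement whose domain mentions a
  project type is probed for `Nonempty` / `IsEmpty` / `Subsingleton` in an empty local context ⇒ a provably EMPTY carrier is a kernel-certified
  FAIL ground `empty-carrier:C:binder` (the crux is vacuous); `unknown` ⇒ ambiguity `carrier-unverified:…` (tier full; chip in quick);
  `Subsingleton` ⇒ informational `trivial-carrier:…`. The summit statement's own binders are probed once, informationally (`tcarrier_summit`).
* t4 METHOD-FAMILY ECHO: tokens of `method_family := "…"` ∪ the closes theorem's `@[method_family]` against every other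
  `@[method_family]` decl (≥ 2 shared tokens, ≥ 1 when the route has ≤ 2) ⇒ matched | unmatched | no-family. (Legacy `technique_class:`
  docstrings are matched by the Python CLI, not here.)
* FORWARD (`mode := forward`, `floor := F`): rung := the first load-bearing crux; `on_path` := s_implies_c(rung); `real_step` := neither
  `Ftype → Rung` nor `Rung` closes cheaply (else `same-rung`, FAIL); `specialises` := `Rung → Ftype` closes cheaply (informational); the
  ladder = the closes binders in order; the floor doubles as the t3k witness.
VERDICT (D-0033 §2b: the kernel check is the tribunal's default path and a kernel FAIL is FINAL). Per crux `t1_kernel = summit-strength` iff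
t1a decisive (clean `iff-summit` / `summit-implies-crux`) ∨ t1c decisive (fired AND the bridge is a LANDED clean theorem) ∨ t1r
joint-unassigned (`via` = b | a | joint). Route `fail` iff an ATTACKED crux is summit-strength or forward `real_step = false` — nothing else
fails (`final.fail_grounds`). Otherwise every open point is an `ambiguity` entry (= `final.eligible_blockers`): rule-d-claim:C / rule-d-exempt:C
(certified strict strengthening without / with a separating witness — the latter makes the verdict `provisional-frontier`), split-dispute,
witness-unverified, witness-regime-unverified (no `s_case`), witness-inside-known-regime:X, barrier-unmatched (the CLI may clear it by its
docstring match), printed-bridge:H / unbridged-hypothesis:H (t1c fired without a landed bridge), t1c-timeout (a bridged hypothesis not fully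
probed), t1a-scan-capped, forward-off-path. Empty ambiguity ∧ no fail ground ⇒ `eligible`; else `provisional`.
PROOF-FORGERY DEFENCE: a tactic-closed goal, a scanned theorem or a witness COUNTS only if the axiom closure of every constant it uses is
⊆ {propext, Classical.choice, Quot.sound} (`Runner.badClosure`; `unclean_ignored` in the JSON). MARKER DEFENCE: `nonce := "…"` is echoed.
Output: human lines + ONE line `H21_TRIBUNAL_JSON {…}` (v 1), the LAST message the command logs. Any exception ⇒ verdict `error`.
-/

open Lean Meta Elab Command
open HarnessLib.Audit HarnessLib.Audit.CruxProbe

namespace HarnessLib.Audit.Tribunal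

/-! ## Options (read BY NAME through `Cfg.ofOptions`, so an inlined copy of this module works too) -/

register_option h21.tribunal.totalMs : Nat := {
  defValue := 170000
  descr := "#h21_tribunal: wall-clock budget of the whole command in tier full (ms; checked between tactic attempts)" }
register_option h21.tribunal.quickTotalMs : Nat := {
  defValue := 25000
  descr := "#h21_tribunal: wall-clock budget of the whole command in tier quick (ms)" }
register_option h21.tribunal.heartbeats : Nat := {
  defValue := 200000
  descr := "#h21_tribunal: maxHeartbeats (×1000) per library-search attempt (`exact?`, tier full only)" }
register_option h21.tribunal.cheapHeartbeats : Nat := {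
  defValue := 50000
  descr := "#h21_tribunal: maxHeartbeats (×1000) per ordinary attempt" }
register_option h21.tribunal.perGoalMs : Nat := {
  defValue := 0
  descr := "#h21_tribunal: wall budget per goal (ms; 0 = tier default: quick 1500 / full 12000)" }
register_option h21.tribunal.maxHyps : Nat := {
  defValue := 40
  descr := "#h21_tribunal: cap on strong hypotheses probed per crux (t1c)" }
register_option h21.tribunal.scanCap : Nat := {
  defValue := 200000
  descr := "#h21_tribunal: cap on constants walked by the landed-converse scan (t1a)" }

/-- Budget knobs (defaults = the option defaults). -/
structure Cfg where
  totalMs : Nat := 170000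
  quickTotalMs : Nat := 25000
  heartbeats : Nat := 200000
  cheapHeartbeats : Nat := 50000
  perGoalMs : Nat := 0
  maxHyps : Nat := 40
  scanCap : Nat := 200000
  deriving Inhabited, Repr

def Cfg.ofOptions (o : Options) : Cfg :=
  let d : Cfg := {}
  { totalMs := o.get `h21.tribunal.totalMs d.totalMs, quickTotalMs := o.get `h21.tribunal.quickTotalMs d.quickTotalMs,
    heartbeats := o.get `h21.tribunal.heartbeats d.heartbeats, cheapHeartbeats := o.get `h21.tribunal.cheapHeartbeats d.cheapHeartbeats,
    perGoalMs := o.get `h21.tribunal.perGoalMs d.perGoalMs, maxHyps := o.get `h21.tribunal.maxHyps d.maxHyps,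
    scanCap := o.get `h21.tribunal.scanCap d.scanCap }

def Cfg.toJson (c : Cfg) : Json :=
  Json.mkObj [("totalMs", c.totalMs), ("quickTotalMs", c.quickTotalMs), ("heartbeats", c.heartbeats), ("cheapHeartbeats", c.cheapHeartbeats),
    ("perGoalMs", c.perGoalMs), ("maxHyps", c.maxHyps), ("scanCap", c.scanCap)]

/-- Effective budgets of one run (tier applied). -/
structure Budget where
  tier : String
  totalMs : Nat
  perGoalMs : Nat
  heartbeats : Nat
  cheapHeartbeats : Nat
  librarySearch : Bool
  deriving Inhabited, Repr

def Budget.ofCfg (c : Cfg) (tier : String) : Budget :=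
  let full := tier == "full"
  { tier := if full then "full" else "quick",
    totalMs := if full then c.totalMs else c.quickTotalMs,
    perGoalMs := if c.perGoalMs != 0 then c.perGoalMs else if full then 12000 else 1500,
    heartbeats := c.heartbeats, cheapHeartbeats := c.cheapHeartbeats, librarySearch := full }

def Budget.toJson (b : Budget) : Json :=
  Json.mkObj [("tier", b.tier), ("totalMs", b.totalMs), ("perGoalMs", b.perGoalMs), ("heartbeats", b.heartbeats),
    ("cheapHeartbeats", b.cheapHeartbeats), ("librarySearch", b.librarySearch)]

/-! ## Small utilities -/

private def strArr (xs : Array String) : Json := Json.arr (xs.map Json.str)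
private def nameArr (xs : Array Name) : Json := strArr (xs.map (·.toString))
private def optStr (o : Option String) : Json := match o with | some s => Json.str s | none => Json.null
private def optName (o : Option Name) : Json := optStr (o.map (·.toString))

/-- Last component of a name. -/
def short (n : Name) : String := match n with | .str _ s => s | _ => n.toString

private def ppE (e : Expr) (n : Nat := 160) : MetaM String := do
  let fmt ← try ppExpr e catch _ => pure (format (toString e))
  return trunc ((fmt.pretty 160).replace "\n" " ") n

/-- Does the tactic string call library search? -/
def isLS (tac : String) : Bool := (tac.splitOn "exact?").length > 1

/-- Head constant of a proposition, looking through metadata, `¬ P` and `P → False`. -/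
def headName? (e : Expr) : Option Name :=
  let e := e.consumeMData
  match e.not? with
  | some p => p.consumeMData.getAppFn.constName?
  | none =>
    match e.arrow? with
    | some (p, q) => if q.consumeMData.isConstOf ``False then p.consumeMData.getAppFn.constName? else none
    | none => e.getAppFn.constName?

/-- The axioms a CLOSED proof may depend on (gate whitelist; `HarnessLib.Audit.Check` is not importable here). -/
def axiomWhitelist : List Name := [``propext, ``Classical.choice, ``Quot.sound]

def axiomsClean (axs : Array Name) : Bool := axs.all fun a => axiomWhitelist.contains a

def isThm (env : Environment) (n : Name) : Bool :=
  match env.find? n with | some (.thmInfo _) => true | _ => false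

/-- Project THEOREMS a proof term leans on (≤ `cap`). -/
def projectTheorems (env : Environment) (pf : Expr) (cap : Nat := 6) : Array Name :=
  (pf.getUsedConstants.filter fun c => isProjectConst env c && isThm env c).extract 0 cap

/-- `n` and the project definitions it delta-reduces to by head (abbrev chains), ≤ 4 deep — the names handed to `simp only […]`. -/
def unfoldChain (env : Environment) (n : Name) : List Name := Id.run do
  let mut out : List Name := []
  let mut cur := n
  for _ in [0:4] do
    unless isProjectConst env cur do break
    match env.find? cur with
    | some (.defnInfo d) =>
      out := out ++ [cur]
      match d.value.getAppFn.constName? with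
      | some nx => if nx == cur then break else cur := nx
      | none => break
    | _ => break
  return out.eraseDups

/-- Is item `X` proved by name (`X_holds` / `X.holds` theorem visible)? -/
def holdsProved (env : Environment) (item : Name) : Bool :=
  match item with
  | .str p s => isThm env (.str p (s ++ "_holds")) || isThm env (.str item "holds")
  | _ => false

/-- Whitespace/comma separated lower-cased tokens. -/
def tokensOf (s : String) : List String :=
  let t := s.map fun ch => if ch == ',' || ch == ';' || ch == '\t' || ch == '\n' then ' ' else ch
  (((t.splitOn " ").filter (· ≠ "")).map String.toLower).eraseDups

/-- Summit key `"S.P"` from a module name `Summits.S.P.Statement` or a decl name `Summit.S.P.Statement` / `Summit.S.P` / `Summit.S`. -/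
def keyOfName? (n : Name) : Option String :=
  let comps := n.components.map (·.toString)
  match comps with
  | r :: rest =>
    if r == "Summits" || r == "Summit" then
      let rest := if rest.getLast? == some "Statement" then rest.dropLast else rest
      match rest with
      | [s] => some s
      | s :: p :: _ => some s!"{s}.{p}"
      | [] => none
    else none
  | [] => none

def summitKey? (env : Environment) (sHead? : Option Name) : Option String :=
  match sHead? with
  | none => none
  | some h =>
    let viaModule := match env.getModuleIdxFor? h with
      | some i => (moduleName? env i.toNat).bind keyOfName?
      | none => none
    viaModule <|> keyOfName? h

/-! ## Thin tactic runner over `CruxProbe.tryTacticOn` -/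

structure Try where
  tactic : String
  ms : Nat
  outcome : String
  deriving Inhabited

def Try.toJson (t : Try) : Json := Json.mkObj [("tactic", t.tactic), ("ms", t.ms), ("outcome", t.outcome)]

/-- Outcome of one goal: first closing tactic wins. -/
structure GoalRes where
  ran : Bool := false
  closed : Bool := false
  tactic : String := ""
  ms : Nat := 0            -- of the closing attempt
  wallMs : Nat := 0        -- of the whole goal
  usesProject : Array Name := #[]
  tries : Array Try := #[]
  cut : String := ""       -- "" | goal-deadline | clause-deadline | total-deadline
  deriving Inhabited

def GoalRes.toJson (g : GoalRes) : Json :=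
  Json.mkObj [("ran", g.ran), ("closed", g.closed), ("tactic", if g.closed then Json.str g.tactic else Json.null), ("ms", g.ms),
    ("wall_ms", g.wallMs), ("uses_project", nameArr g.usesProject), ("attempts", g.tries.size), ("cut", g.cut)]

def GoalRes.brief (g : GoalRes) : String :=
  if !g.ran then "n/a" else if g.closed then s!"CLOSED `{g.tactic}` {g.ms}ms" ++ (if g.usesProject.isEmpty then "" else s!" uses {(g.usesProject.toList.take 3).map short}")
  else s!"open ({g.tries.size} attempts, {g.wallMs}ms" ++ (if g.cut.isEmpty then ")" else s!", {g.cut})")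

/-- Shared run state: budgets, the command's start, unavailable tactics, attempt count. -/
structure Runner where
  b : Budget
  t0 : Nat
  unavailable : Array String := #[]
  attempts : Nat := 0
  trace : Array (String × Try) := #[]     -- (goal label, attempt)
  /-- per-constant cache of NON-whitelisted axioms in the constant's closure (proof-forgery defence) -/
  ax : Std.HashMap Name (Array Name) := {}
  /-- tactic-closed goals / scanned hits / witnesses NOT counted because their axiom closure is unclean -/
  uncleanIgnored : Nat := 0
  uncleanSeen : Array String := #[]
  deriving Inhabited

def Runner.deadline (r : Runner) : Nat := r.t0 + r.b.totalMs

/-- Non-whitelisted axioms in the closure of `consts` (per constant `Lean.collectAxioms` — O(1) for imported decls in this toolchain, a body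
walk for local ones — cached in the runner). A constant MISSING from the environment (an auxiliary decl rolled back together with the
tactic's environment changes, e.g. `native_decide`'s `ofReduceBool` companion) counts as unclean. `sorryAx`, `Lean.ofReduceBool`,
`Lean.trustCompiler` and any postulated `axiom` all disqualify; only `propext` / `Classical.choice` / `Quot.sound` pass. -/
def Runner.badClosure (r : Runner) (consts : Array Name) (aux : Array (Name × Array Name) := #[]) : MetaM (Array Name × Runner) := do
  let env ← getEnv
  let mut r := r
  let mut bad : Array Name := #[]
  for c in consts do
    let axs ← match r.ax.get? c with
      | some a => pure a
      | none => do
        let a ← if env.contains c then collectAxioms c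
          else match aux.find? (·.1 == c) with
            | some (_, axs) => pure axs                       -- auxiliary constant of the tactic run: axioms collected while it existed
            | none => pure #[Name.mkSimple s!"?{c}"]
        let a := a.filter fun x => !axiomWhitelist.contains x
        if env.contains c then r := { r with ax := r.ax.insert c a }
        pure a
    for a in axs do
      unless bad.contains a do bad := bad.push a
  return (bad, r)

/-- Is declaration `n` axiom-clean (its own closure)? -/
def Runner.declClean (r : Runner) (n : Name) : MetaM (Bool × Array Name × Runner) := do
  let (bad, r) ← r.badClosure #[n]
  return (bad.isEmpty, bad, r)

private def Runner.noteUnclean (r : Runner) (what : String) : Runner :=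
  { r with uncleanIgnored := r.uncleanIgnored + 1, uncleanSeen := if r.uncleanSeen.size < 12 then r.uncleanSeen.push what else r.uncleanSeen }

/-- Like `CruxProbe.tryTacticOn`, but ALSO returns the axiom closure of any constant the proof uses that exists only inside the tactic run
(auxiliary `_proof_n` / `_auxLemma` decls abstracted by `omega`, `decide`, `norm_num` …): those vanish with `withoutModifyingEnv`, so their axioms
must be collected while they exist — otherwise the forgery defence would (and did, 2026-08-18) reject every honest proof that abstracts a nested lemma. -/
def tryTacticAx (goal : Expr) (tac : String) (heartbeats : Nat) : TermElabM (TacOutcome × Array (Name × Array Name)) := do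
  let env0 ← getEnv
  match Parser.runParserCategory env0 `tactic s!"({tac})" "<h21_tribunal>" with
  | .error _ => return (.unavailable, #[])
  | .ok stx =>
    let g ← mkFreshExprMVar (some goal) (kind := .syntheticOpaque)
    let start ← IO.getNumHeartbeats
    withTheReader Core.Context (fun c => { c with initHeartbeats := start, maxHeartbeats := heartbeats * 1000 }) do
      tryCatchRuntimeEx
        (do
          let r ← Term.withDeclName `_h21_tribunal <| Term.withoutErrToSorry <| withoutModifyingEnv do
            let gs ← Tactic.run g.mvarId! (Tactic.evalTactic stx)
            unless gs.isEmpty do return (TacOutcome.failed "goals remain", #[])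
            let pf ← instantiateMVars g
            if pf.hasExprMVar then return (TacOutcome.failed "unassigned metavariables", #[])
            if pf.getUsedConstants.contains ``sorryAx then return (TacOutcome.failed "proof uses sorry", #[])
            -- auxiliary constants: present now, absent from env0 — collect their axiom closures while they exist
            let envNow ← getEnv
            let mut aux : Array (Name × Array Name) := #[]
            for c in pf.getUsedConstants do
              if !env0.contains c && envNow.contains c then
                aux := aux.push (c, ← collectAxioms c)
            return (TacOutcome.closed pf, aux)
          return r)
        (fun e => do return (.failed (trunc (← e.toMessageData.toString) 200), #[]))

/-- Try `tactics` in order on the CLOSED goal `goal`; a proof using a constant of `exclude` does not count. Deadlines (goal / clause /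
total) are checked between attempts; a running attempt is bounded by heartbeats only. Never throws. -/
def runGoal (r : Runner) (label : String) (goal : Expr) (tactics : Array String) (exclude : Array Name := #[]) (budgetMs : Nat := 0)
    (clauseDeadline : Nat := 0) (hb : Nat := 0) : TermElabM (GoalRes × Runner) := do
  let env ← getEnv
  let mut r := r
  let mut res : GoalRes := { ran := true }
  let ta ← IO.monoMsNow
  let goalDeadline := ta + (if budgetMs == 0 then r.b.perGoalMs else budgetMs)
  for tac in tactics do
    if isLS tac && !r.b.librarySearch then continue
    let now ← IO.monoMsNow
    let cut := if now > r.deadline then "total-deadline" else if clauseDeadline != 0 && now > clauseDeadline then "clause-deadline"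
      else if now > goalDeadline then "goal-deadline" else ""
    unless cut.isEmpty do
      res := { res with cut, tries := res.tries.push { tactic := tac, ms := 0, outcome := cut } }
      break
    let a ← IO.monoMsNow
    let (out, aux) ← tryTacticAx goal tac (if isLS tac then r.b.heartbeats else if hb != 0 then hb else r.b.cheapHeartbeats)
    let ms := (← IO.monoMsNow) - a
    r := { r with attempts := r.attempts + 1 }
    match out with
    | .closed pf =>
      let used := pf.getUsedConstants
      let excluded := used.filter fun c => exclude.contains c
      unless excluded.isEmpty do
        let t : Try := { tactic := tac, ms, outcome := s!"excluded: proof uses {(excluded.toList.take 3)}" }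
        res := { res with tries := res.tries.push t }
        r := { r with trace := r.trace.push (label, t) }
        continue
      -- proof-forgery defence: the proof term's axiom closure must be clean (a proof that merely USES a sorried / native_decide'd /
      -- postulated lemma carries no `sorryAx` itself)
      let (bad, r') ← r.badClosure used aux
      r := r'
      unless bad.isEmpty do
        let t : Try := { tactic := tac, ms, outcome := s!"closed-unclean: {(bad.toList.take 4)}" }
        res := { res with tries := res.tries.push t }
        r := (r.noteUnclean s!"{label} `{tac}` {(bad.toList.take 2)}")
        r := { r with trace := r.trace.push (label, t) }
        continue
      let t : Try := { tactic := tac, ms, outcome := "closed" }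
      res := { res with closed := true, tactic := tac, ms, usesProject := projectTheorems env pf, tries := res.tries.push t }
      r := { r with trace := r.trace.push (label, t) }
      break
    | .unavailable =>
      unless r.unavailable.contains tac do r := { r with unavailable := r.unavailable.push tac }
      res := { res with tries := res.tries.push { tactic := tac, ms, outcome := "unavailable" } }
    | .failed msg =>
      let t : Try := { tactic := tac, ms, outcome := "failed: " ++ trunc (msg.replace "\n" " ") 70 }
      res := { res with tries := res.tries.push t }
      r := { r with trace := r.trace.push (label, t) }
  res := { res with wallMs := (← IO.monoMsNow) - ta }
  return (res, r)

/-! ## Portfolios (fixed order) -/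

/-- `S → C` specialisation tactics (C a conjunct / instance of S), appended to the non-library-search summit tactics. -/
def spTactics : Array String :=
  #["intro h; exact h _", "intro h; exact h.1", "intro h; exact h.2", "intro h; exact (h _).1", "intro h; exact (h _).2",
    "intro h; exact fun x => h _ x", "intro h; exact fun x hx => h x _",
    -- threshold / regime monotonicity (`∀ n ≥ a, P n` ⇒ `∀ n ≥ b, P n`, b ≥ a), also under a leading conjunction
    "intro h; intro x hx; first | exact h x (by omega) | exact h.1 x (by omega) | exact h.2 x (by omega) | exact h x (by linarith) | exact h.1 x (by linarith)"]

/-- t1c pass A (every hypothesis, milliseconds each): identity by delta (`H` verbatim `C`) and the STRUCTURAL shortcuts (`T` = landed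
project theorems concluding `C`, from the t1a scan — `exact T h` closes by delta when `H`'s definiens is verbatim `T`'s hypothesis, without
the library index). -/
def strongHypDefeqTactics (structural : Array Name) : Array String :=
  #["exact fun h => h", "intro h; exact h"] ++ (structural.map fun t => s!"intro h; exact {t} h")

/-- t1c pass S (rank order): structural shortcuts modulo `simp` normalisation of `H`, then the cheap normalising portfolio. -/
def strongHypCheapTactics (cU hU : String) (structural : Array Name) : Array String :=
  (structural.map fun t => s!"intro h; exact {t} (by simpa [{hU}] using h)") ++
  #["intro h; simpa using h", s!"intro h; simpa [{cU}, {hU}] using h", "intro h; aesop", s!"intro h; (try simp only [{cU}, {hU}] at h ⊢); tauto"]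

/-- t1c pass B (tier full): library search. -/
def strongHypLSTactics (hU : String) : Array String :=
  #["intro h; exact?", s!"intro h; (try simp only [{hU}] at h); exact?"]

/-- Constants too ubiquitous to signal relevance between a hypothesis and a crux. -/
def basicRoots : List Name :=
  [`Nat, `Int, `Real, `Complex, `NNReal, `ENNReal, `Rat, `Fin, `Set, `Finset, `Function, `Classical, `Decidable, `OfNat, `HAdd, `HMul,
   `HSub, `HDiv, `HPow, `HSMul, `LE, `LT, `GE, `GT, `Eq, `Ne, `And, `Or, `Not, `Iff, `Exists, `True, `False, `Membership, `Subtype, `Prod,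
   `Sigma, `Unit, `Bool, `List, `Array, `Option, `id, `Max, `Min, `Top, `Bot, `Preorder, `PartialOrder, `LinearOrder]

/-- Does constant `n` count for the relevance overlap? Project constants count triple (see `relevance`); library constants count once unless
they live in `Init`, are instances (`inst…`), or sit under a `basicRoots` namespace. -/
def relevantConst (env : Environment) (n : Name) : Bool :=
  if isProjectConst env n then true else
  let root := n.getRoot
  let lastIsInst := match n with | .str _ s => s.startsWith "inst" | _ => false
  let inInit := match env.getModuleIdxFor? n with
    | some i => (match moduleName? env i.toNat with | some m => m.getRoot == `Init | none => false)
    | none => false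
  !(basicRoots.contains root || lastIsInst || inInit)

/-- Relevance of hypothesis constants `hs` to crux constants `cs`: 3 × shared project constants + shared relevant library constants. -/
def relevance (env : Environment) (cs : Std.HashSet Name) (hs : Array Name) : Nat := Id.run do
  let mut sc := 0
  for n in hs.toList.eraseDups do
    if cs.contains n && relevantConst env n then sc := sc + (if isProjectConst env n then 3 else 1)
  return sc

/-- Constants of a decl's statement AND definiens (for defs), of the type only otherwise. -/
def declConsts (env : Environment) (n : Name) : Array Name :=
  match env.find? n with
  | some (.defnInfo d) => d.type.getUsedConstants ++ d.value.getUsedConstants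
  | some ci => ci.type.getUsedConstants
  | none => #[]

/-- forward `real_step`: close `Ftype → Rung` / `Rung` cheaply (`rU` = rung unfold names, `F` = the floor theorem). -/
def sameRungTactics (rU : String) (F : Name) : Array String :=
  rigidTactics ++ #[s!"intro h; simpa [{rU}] using h", s!"intros; simpa [{rU}] using {F}", s!"intros; exact {F}"]

/-- forward `specialises`: `Rung → Ftype` cheaply. -/
def specialiseTactics (rU : String) : Array String :=
  #["intro h; exact h _", "intro h; exact h", s!"intro h; simpa [{rU}] using h", s!"intro h; simpa [{rU}] using h _", "intro h; aesop",
    s!"intro h; (try simp only [{rU}] at h ⊢); aesop", "intro h x; exact h _ x", "intro h; omega"]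

/-- t3k `s_case` portfolio. -/
def sCaseTactics (full : Bool) : Array String :=
  #["simp_all", "aesop", "decide", "intros; norm_num", "intros; omega"] ++ (if full then #["exact?"] else #[])

/-! ## t1a: landed converse / equivalence scan -/

structure ScanHit where
  crux : Name
  decl : Name
  kind : String
  clean : Bool
  hyp? : Option Name := none
  bad : Array Name := #[]
  deriving Inhabited

def ScanHit.decisive (h : ScanHit) : Bool := (h.kind == "iff-summit" || h.kind == "summit-implies-crux") && h.clean

def ScanHit.toJson (h : ScanHit) : Json :=
  Json.mkObj [("decl", h.decl.toString), ("kind", h.kind), ("clean", h.clean), ("decisive", h.decisive), ("hypothesis", optName h.hyp?),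
    ("unclean_axioms", nameArr h.bad)]

/-- One pass over the project theorems visible from the file (imported project modules, capped, then this file). `clean` is left `true`
here; the caller re-decides it through the runner's cached axiom closure. -/
def scanConverse (env : Environment) (cap : Nat) (cruxes : Array Name) (s : Expr) (sHead? : Option Name) (strong : Array Name)
    (closesThms : Array Name) (isRouteItem : Name → Bool) : MetaM (Array ScanHit × Nat) := do
  -- summit-EQUIVALENT LEAVES (F7 2026-08-18): the summit head and every project definition it delta-unfolds to (`KontsevichZagierPeriods :=
  -- Literature.Periods.KZPeriodConjecture`, `PneNP := Literature.PNP.PNeNP` …) count as `S` in `C ↔ S'` / `S' → C`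
  let sHeads : List Name := match sHead? with | some h => (h :: unfoldChain env h).eraseDups | none => []
  let mut thms : Array Name := #[]
  let mut scanned := 0
  for hh : mi in [0:env.header.modules.size] do
    if scanned ≥ cap then break
    if libraryRoots.contains env.header.modules[mi].module.getRoot then continue
    let some md := env.header.moduleData[mi]? | continue
    for n in md.constNames do
      scanned := scanned + 1
      if let some (.thmInfo _) := env.find? n then thms := thms.push n
  thms := env.constants.foldStage2 (fun acc n c => match c with | .thmInfo _ => acc.push n | _ => acc) thms
  scanned := scanned + env.constants.foldStage2 (fun acc _ _ => acc + 1) 0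
  let s := s.consumeMData
  let mut hits : Array ScanHit := #[]
  for n in thms do
    if closesThms.contains n then continue
    let some ci := env.find? n | continue
    let used := ci.type.getUsedConstants
    let mentioned := cruxes.filter fun c => used.contains c
    if mentioned.isEmpty then continue
    let kinds ← forallTelescope ci.type fun xs body => do
      let body := (← instantiateMVars body).consumeMData
      let mut bHeads : Array Name := #[]
      for x in xs do
        let ty ← instantiateMVars (← inferType x)
        if ← isProp ty then bHeads := bHeads.push ((headName? ty).getD `_nonconst)
      let isS (e : Expr) : Bool := (match headName? e with | some h => sHeads.contains h | none => false) || e.consumeMData == s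
      let sInBinders : Bool := bHeads.any fun h => sHeads.contains h
      -- FINAL-fail policy (D-0033 §2b): an equivalence / converse counts as DECISIVE only when every OTHER Prop hypothesis of the theorem is CLOSED —
      -- a landed theorem, or an item with a `_holds` proof; an open route item, an undischarged named fact or a strong hypothesis in the binders makes the
      -- hit CONDITIONAL (`iff-summit-conditional:k` / `summit-implies-crux-conditional:k`, informational + ambiguity), never a fail ground.
      let binderClosed (h : Name) : Bool := h != `_nonconst && (isThm env h || holdsProved env h)
      let openOthers (skip : Name → Bool) : Nat := (bHeads.filter fun h => !skip h && !binderClosed h).size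
      let mut out : Array (Name × String × Option Name) := #[]
      for c in mentioned do
        match body.app2? ``Iff with
        | some (a, b) =>
          let ha := headName? a
          let hb := headName? b
          if (ha == some c && isS b) || (hb == some c && isS a) then
            let k := openOthers fun _ => false
            out := out.push (c, (if k == 0 then "iff-summit" else s!"iff-summit-conditional:{k}"), none)
          else
            let other? : Option Name := if ha == some c then hb else if hb == some c then ha else none
            match other? with
            | some o =>
              if strong.contains o then out := out.push (c, s!"iff-hypothesis:{short o}", some o)
              else out := out.push (c, s!"iff-other:{short o}", none)
            | none => pure ()
        | none =>
          let hc := headName? body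
          if hc == some c then
            if sInBinders then
              let k := openOthers fun h => sHeads.contains h
              out := out.push (c, (if k == 0 then "summit-implies-crux" else s!"summit-implies-crux-conditional:{k}"), none)
            else
              match bHeads.find? fun h => strong.contains h with
              | some h => out := out.push (c, s!"hypothesis-implies-crux:{short h}", some h)
              | none => out := out.push (c, s!"implies-crux:{bHeads.size}", none)      -- structural candidate for t1c (`exact T h`)
          else if (isS body) && bHeads.contains c then
            let others := bHeads.filter (· != c)
            if others.all (fun o => !isRouteItem o || holdsProved env o) then out := out.push (c, "crux-implies-summit-landed", none)
            else out := out.push (c, "crux-implies-summit-conditional", none)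
      return out
    for (c, k, h?) in kinds do hits := hits.push { crux := c, decl := n, kind := k, clean := true, hyp? := h? }   -- `clean` is decided by the caller (cached closure)
  return (hits, scanned)

/-! ## F3 QUANTIFIER-SHAPE (FILTER-SYNTHESIS 2026-08-18): is the rung merely an INSTANTIATION / finite truncation of the summit's leading ∀? -/

/-- Unfold project Prop definitions at the head of `e` (≤ 3 layers) and return it. -/
private def unfoldHeadProp (env : Environment) (e : Expr) : MetaM Expr := do
  let mut t := e
  for _ in [0:3] do
    let t' ← whnfR t
    match projectPropDefHead? env t' with
    | some _ => match ← unfoldDefinition? t' with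
      | some u => t := u
      | none => return t'
    | none => return t'
  whnfR t

/-- `some why` when the rung `R` (closed Prop) is, up to defeq, `P n₀` for a closed `n₀`, or `∀ n, n ≤ c → P n` / `∀ n, n < c → P n` /
`∀ n ∈ s, P n`, where the summit `S` unfolds to `∀ n, P n`. This is a kernel-level fact (isDefEq), so it may ground a forward FAIL. -/
def instantiationShape (env : Environment) (s : Expr) (r : Expr) : MetaM (Option String) := do
  let sT ← unfoldHeadProp env s
  unless sT.isForall do return none
  let rT ← unfoldHeadProp env r
  -- (a) R ≡ P n₀ : open S's first binder as a metavariable and unify the body with R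
  let a? ← withNewMCtxDepth do
    let dom := sT.bindingDomain!
    if (← isProp dom) then return none                       -- `H → …` is an implication, not a quantifier over data
    let m ← mkFreshExprMVar (some dom)
    let body := sT.bindingBody!.instantiate1 m
    if ← isDefEq body rT then
      let v ← instantiateMVars m
      if !v.hasMVar && !v.hasFVar then return some s!"rung ≡ summit body at {← ppE v 60} (P n₀ for a closed n₀)" else return none
    else return none
  if a?.isSome then return a?
  -- (b) R ≡ ∀ n, (n ≤ c | n < c | n ∈ s) → P n  (finite truncation of the leading ∀)
  unless rT.isForall do return none
  let b? ← withNewMCtxDepth <| forallBoundedTelescope rT (some 1) fun xs rb => do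
    if xs.size != 1 then return none
    let x := xs[0]!
    let rb ← whnfR rb
    unless rb.isForall do return none
    let hyp := rb.bindingDomain!
    unless ← isProp hyp do return none
    let hd := hyp.getAppFn.constName?
    let isBound := match hd with
      | some n => n == ``LE.le || n == ``LT.lt || n == ``Membership.mem || n == ``GE.ge || n == ``GT.gt
      | none => false
    unless isBound do return none
    let args := hyp.getAppArgs
    -- the bound must mention x and otherwise be closed
    unless args.any (fun a => a.containsFVar x.fvarId!) do return none
    let others := args.filter fun a => !(a.containsFVar x.fvarId!)
    unless others.all (fun a => !a.hasFVar && !a.hasMVar) do return none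
    let inner := rb.bindingBody!
    if inner.hasLooseBVars then return none                  -- the conclusion uses the bound hypothesis: not a plain truncation
    let sDom := sT.bindingDomain!
    unless ← isDefEq sDom (← inferType x) do return none
    let sBody := sT.bindingBody!.instantiate1 x
    if ← isDefEq sBody inner then return some s!"rung ≡ ∀ n, ({← ppE hyp 50}) → summit body (finite truncation of the leading ∀)" else return none
  return b?

/-! ## Records -/

/-- A `@[summit_bridge]` in scope. -/
structure Bridge where
  decl : Name
  kind : String          -- landed | printed
  key : String
  mentions : Array Name
  clean : Bool := true   -- landed: the theorem's (or `_holds`') axiom closure is clean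
  /-- the bridge is an EQUIVALENCE `H ↔ P` (a registered CRITERION): H is summit-equivalent, so rule (a) via H is degenerate (converse-only). -/
  isIff : Bool := false
  deriving Inhabited

/-- One strong hypothesis tried against one crux (t1c). -/
structure HypTry where
  hyp : Name
  bridgeKind : String    -- landed | printed | none
  bridge? : Option Name
  outcome : String       -- fired | open | cut | skipped:<why> | skipped-irrelevant
  tactic : String := ""
  ms : Nat := 0
  usesProject : Array Name := #[]
  rank : Nat := 0        -- relevance rank (1 = most constants shared with the crux)
  overlap : Nat := 0     -- relevance score (3 × shared project constants + shared non-basic library constants)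
  phase : String := ""   -- which pass closed it: A (defeq / structural) | S (cheap portfolio) | B (library search)
  phases : String := ""  -- passes COMPLETED for this hypothesis without a budget cut (e.g. "AS", "ASB")
  bridgeClean : Bool := true   -- the landed bridge theorem's axiom closure is clean
  /-- `S → H` closes cheaply: the "strong" hypothesis is IMPLIED BY the summit, hence (with its bridge) EQUIVALENT to it — then `H → C` is only
  `S → C` (converse-only) and rule (a) certifies nothing. Guard added 2026-08-17 (final-fail policy). -/
  restatesSummit : Bool := false
  restatesBy : String := ""
  /-- the crux closes WITHOUT the hypothesis under the same tactic (C is provable outright / already in the tree): `H → C` is then trivial and rule (a) says nothing. -/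
  cruxProvable : Bool := false
  cruxProvableBy : String := ""
  deriving Inhabited

def HypTry.fired (h : HypTry) : Bool := h.outcome == "fired"
/-- Kernel-CERTIFIED rule (a): fired AND the bridge `H → S` is a LANDED, axiom-clean theorem (D-0033 §2b: a kernel FAIL is final; a printed
bridge or an unbridged hypothesis is reported but only makes the route provisional). -/
def HypTry.decisive (h : HypTry) : Bool := h.fired && h.bridgeKind == "landed" && h.bridgeClean && !h.restatesSummit && !h.cruxProvable

def HypTry.toJson (h : HypTry) : Json :=
  Json.mkObj [("hypothesis", h.hyp.toString), ("bridge_kind", h.bridgeKind), ("bridge", optName h.bridge?), ("outcome", h.outcome),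
    ("tactic", if h.fired then Json.str h.tactic else Json.null), ("ms", h.ms), ("uses_project", nameArr h.usesProject), ("decisive", h.decisive),
    ("rank", h.rank), ("overlap", h.overlap), ("pass", h.phase), ("passes_completed", h.phases), ("bridge_clean", h.bridgeClean),
    ("restates_summit", h.restatesSummit), ("restates_by", (h.restatesBy : Json)), ("crux_provable", h.cruxProvable), ("crux_provable_by", (h.cruxProvableBy : Json))]

/-- One hard-core registry hit for a crux (t1h, FILTER-SYNTHESIS F1): never a fail ground — a frontier-shelf flag. -/
structure HcHit where
  core : Name
  print : String := ""
  direction : String       -- tagged-self | c-implies-core | core-implies-c | iff-landed | implies-landed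
  by_ : String := ""
  ms : Nat := 0
  owner? : Option String := none
  deriving Inhabited

def HcHit.toJson (h : HcHit) : Json :=
  Json.mkObj [("core", h.core.toString), ("print", h.print), ("direction", h.direction), ("by", h.by_), ("ms", h.ms), ("owner", match h.owner? with | some o => (o : Json) | none => Json.null)]

/-- Everything measured for one load-bearing crux. -/
structure CruxRes where
  name : Name
  role : String := "attacked"
  closed : Bool := true          -- the crux constant is a closed Prop
  note : String := ""
  t1aHits : Array ScanHit := #[]
  t1aMs : Nat := 0
  cToS : GoalRes := {}
  sToC : GoalRes := {}
  t1bMs : Nat := 0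
  t1cTried : Array HypTry := #[]
  t1cMs : Nat := 0
  t1cVerdict : String := "skipped"
  t1cInScope : Nat := 0
  t1cBudgetMs : Nat := 0
  t1cCutAfterRank : Option Nat := none
  t1cSkippedIrrelevant : Nat := 0
  t1cStructural : Nat := 0       -- landed theorems concluding C tried as `exact T h`
  t1r : String := "not-joint"
  /-- C ⇒ S is CERTIFIED for this crux independently of the scan: the route has a `@[closes]` theorem AND every OTHER load-bearing binder is proved
  (`_holds`). Together with `cToS.closed` (t1b, C → S cheap) and a clean `crux-implies-summit-landed` hit it decides whether a landed CONVERSE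
  (`summit-implies-crux`, S → C) completes rule (b): without it, S → C only says C is a CONSEQUENCE of S — the expected shape of an honest rung. -/
  siblingsProved : Bool := false
  hcHits : Array HcHit := #[]
  hcInScope : Nat := 0
  hcMs : Nat := 0
  hcTried : Array String := #[]     -- per core: outcomes of the cheap attempts (debug / evidence of what was tried)
  tcRows : Array CarrierProbe.Row := #[]
  tcMs : Nat := 0
  tcRan : Bool := false
  tcNote : String := ""
  deriving Inhabited

def CruxRes.tcEmpty (c : CruxRes) : Array CarrierProbe.Row := c.tcRows.filter (·.status == "empty")
def CruxRes.tcUnknown (c : CruxRes) : Array CarrierProbe.Row := c.tcRows.filter fun r => r.status == "unknown" || r.status == "error"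
def CruxRes.tcTrivial (c : CruxRes) : Array CarrierProbe.Row := c.tcRows.filter (·.trivial)
def CruxRes.tcVerdict (c : CruxRes) : String :=
  if !c.tcRan then "skipped" else if !c.tcEmpty.isEmpty then "empty" else if !c.tcUnknown.isEmpty then "unknown" else "clean"
def CruxRes.tcJson (c : CruxRes) : Json :=
  Json.mkObj [("verdict", c.tcVerdict), ("rows", Json.arr (c.tcRows.map (·.toJson))), ("empty", strArr (c.tcEmpty.map (·.carrier))),
    ("unknown", strArr (c.tcUnknown.map (·.carrier))), ("trivial", strArr (c.tcTrivial.map (·.carrier))), ("ms", c.tcMs), ("note", c.tcNote)]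

def CruxRes.cToSCertified (c : CruxRes) : Bool :=
  c.cToS.closed || c.siblingsProved || c.t1aHits.any (fun h => h.kind == "crux-implies-summit-landed" && h.clean)
/-- Rule (b) needs BOTH directions: an `iff-summit` hit is decisive by itself; a `summit-implies-crux` hit (S → C landed) only when C ⇒ S is certified. -/
def CruxRes.t1aDecisive (c : CruxRes) : Array ScanHit :=
  c.t1aHits.filter fun h => h.decisive && (h.kind == "iff-summit" || c.cToSCertified)
/-- Landed converses S → C whose other direction is NOT certified: `converse-only` (ambiguity), never a fail ground (final-fail policy 2026-08-17). -/
def CruxRes.t1aConverseOnly (c : CruxRes) : Array ScanHit :=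
  c.t1aHits.filter fun h => h.decisive && h.kind == "summit-implies-crux" && !c.cToSCertified
def CruxRes.t1aVerdict (c : CruxRes) : String :=
  if !c.t1aDecisive.isEmpty then "fired" else if (c.t1aHits.filter fun h => !(h.kind.startsWith "implies-crux")).isEmpty then "clean" else "informational"
def CruxRes.t1cFired (c : CruxRes) : Array HypTry := c.t1cTried.filter (·.fired)
def CruxRes.t1cDecisive (c : CruxRes) : Array HypTry := c.t1cTried.filter (·.decisive)
def CruxRes.ruleD (c : CruxRes) : Bool := c.cToS.closed
def CruxRes.sImpliesC (c : CruxRes) : Bool := c.sToC.closed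
def CruxRes.via (c : CruxRes) : Option String :=
  if !c.t1aDecisive.isEmpty then some "b" else if !c.t1cDecisive.isEmpty then some "a" else if c.t1r == "joint-unassigned" then some "joint" else none
def CruxRes.t1Kernel (c : CruxRes) : String := if c.via.isSome then "summit-strength" else "clean"

def CruxRes.evidence (c : CruxRes) : String :=
  if let some r := c.tcEmpty[0]? then s!"carrier {r.carrier} : {trunc r.shown 80} is provably EMPTY ({r.by_}): the crux is vacuous" else
  match c.t1aDecisive[0]?, c.t1cDecisive[0]?, c.t1cFired[0]? with
  | some h, _, _ => s!"{h.kind}: {h.decl} (axiom-clean)"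
  | none, some h, _ => s!"{short h.hyp} → {short c.name} by `{h.tactic}` in {h.ms}ms; bridge {h.bridgeKind}" ++ (match h.bridge? with | some b => s!" ({b})" | none => "")
  | none, none, some h => s!"{short h.hyp} → {short c.name} by `{h.tactic}` ({h.ms}ms) but no bridge registered for {short h.hyp} (not decisive)"
  | none, none, none =>
    if c.t1r == "joint-unassigned" then "S → C closes for every load-bearing crux and no residual is declared"
    else if c.ruleD then s!"C → S closes by `{c.cToS.tactic}` (rule (d) premise; separating witness needed)"
    else if !c.closed then c.note
    else "no kernel evidence of summit strength"

def CruxRes.toJson (c : CruxRes) (strengthening : Json := Json.null) : Json :=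
  Json.mkObj [
    ("name", short c.name), ("decl", c.name.toString), ("role", c.role), ("t1_kernel", c.t1Kernel), ("via", optStr c.via),
    ("rule_d_premise", c.ruleD), ("c_to_s_certified", c.cToSCertified), ("siblings_proved", c.siblingsProved), ("strengthening", if c.ruleD && c.via.isNone then strengthening else Json.null), ("evidence", c.evidence), ("note", c.note),
    ("t1a", Json.mkObj [("verdict", c.t1aVerdict), ("hits", Json.arr (c.t1aHits.map (·.toJson))), ("ms", c.t1aMs)]),
    ("t1b", Json.mkObj [("verdict", if !c.closed then "skipped" else if c.ruleD then "fired" else "clean"),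
                        ("c_implies_s", c.cToS.toJson), ("s_implies_c", c.sToC.toJson), ("ms", c.t1bMs)]),
    ("t1c", Json.mkObj [("verdict", c.t1cVerdict), ("hypotheses_in_scope", c.t1cInScope), ("hypotheses_tried", (c.t1cTried.filter fun h => !(h.outcome.startsWith "skipped")).size),
                        ("fired", Json.arr (c.t1cFired.map (·.toJson))),
                        ("tried", Json.arr (c.t1cTried.map fun h => Json.mkObj [("hypothesis", h.hyp.toString), ("bridge_kind", h.bridgeKind), ("outcome", h.outcome), ("ms", h.ms), ("rank", h.rank), ("overlap", h.overlap), ("passes_completed", h.phases)])),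
                        ("budget_ms", c.t1cBudgetMs), ("cut_after_rank", match c.t1cCutAfterRank with | some r => (r : Json) | none => Json.null),
                        ("skipped_irrelevant", c.t1cSkippedIrrelevant), ("structural_candidates", c.t1cStructural), ("ms", c.t1cMs)]),
    ("t1r", Json.mkObj [("verdict", c.t1r), ("s_implies_c", c.sImpliesC)]), ("tcarrier", c.tcJson),
    ("t1h", Json.mkObj [("verdict", (if c.hcHits.isEmpty then "clean" else "hard-core" : String)), ("in_scope", c.hcInScope), ("ms", c.hcMs), ("hits", Json.arr (c.hcHits.map (·.toJson))),
      ("tried", strArr c.hcTried)])]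

/-- Parsed command arguments. -/
structure Inputs where
  rid : String
  summit? : Option Name := none
  cruxes : Array Name := #[]
  witness? : Option Name := none
  sCase? : Option Name := none
  residual : Array Name := #[]
  mode : String := "topdown"
  floor? : Option Name := none
  transfer? : Option Name := none   -- F3: a monotonicity/compactness transfer theorem exempting an instantiation-shaped rung
  tier : String := "quick"
  family : String := ""
  nonce? : Option String := none
  deriving Inhabited, Repr

def Inputs.toJson (i : Inputs) : Json :=
  Json.mkObj [("route", i.rid), ("summit", optName i.summit?), ("cruxes", nameArr i.cruxes), ("witness", optName i.witness?),
    ("s_case", optName i.sCase?), ("residual", nameArr i.residual), ("mode", i.mode), ("floor", optName i.floor?), ("tier", i.tier),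
    ("method_family", i.family)]

def marker : String := "H21_TRIBUNAL_JSON"

/-- Chips the literature seats decide (always carried). -/
def literatureChips : Array String := #["t1c-print-placement", "t2-named-open-problem", "t2-novelty", "t2-openness", "t5-ceiling", "t4-docstring-match-in-cli"]

def errorResult (inp : Inputs) (why : String) : Array String × Json :=
  (#[s!"#h21_tribunal {inp.rid}: ERROR {why}", "VERDICT: error"],
   Json.mkObj [("h21_tribunal", inp.rid), ("route", inp.rid), ("verdict", "error"), ("error", why), ("reasons", strArr #["error"]), ("ambiguity", strArr #["error"]),
     ("final", Json.mkObj [("fail_grounds", Json.arr #[]), ("eligible_blockers", strArr #["error"]), ("kernel_final", false), ("judge_needed", false)]),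
     ("chips", strArr literatureChips), ("feedback", strArr #[s!"fix the command inputs: {why}"]), ("mode", inp.mode), ("tier", inp.tier),
     ("inputs", inp.toJson), ("nonce", optStr inp.nonce?), ("v", (1 : Nat))])

/-! ## t3k witness -/

structure WitnessInfo where
  given : Option Name := none
  verdict : String := "absent"      -- present | absent | error
  why : String := ""
  type : String := ""
  clean : Bool := false
  axioms : Array Name := #[]
  mentionsCrux : Bool := false
  deriving Inhabited

def witnessInfo (env : Environment) (w? : Option Name) (crux? : Option Name) (bad : Array Name) : MetaM WitnessInfo := do
  match w? with
  | none => return {}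
  | some w =>
    match env.find? w with
    | none => return { given := some w, verdict := "error", why := s!"unknown witness declaration {w}" }
    | some (.thmInfo ti) =>
      let axs := bad
      let clean := bad.isEmpty
      let used := ti.type.getUsedConstants
      let mentions := match crux? with
        | some c => used.contains c || used.any fun u => u.getPrefix == c.getPrefix && isProjectConst env u && u != w
        | none => false
      return { given := some w, verdict := if clean then "present" else "error", why := if clean then "" else s!"witness is not axiom-clean: depends on {axs.toList}",
               type := (← ppE ti.type 300), clean, axioms := axs, mentionsCrux := mentions }
    | some _ => return { given := some w, verdict := "error", why := s!"{w} is not a theorem (a witness is a PROVED rung)" }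

def WitnessInfo.toJson (w : WitnessInfo) : Json :=
  Json.mkObj [("verdict", w.verdict), ("witness", optName w.given), ("witness_type", w.type), ("clean", w.clean), ("why", w.why),
    ("axioms", nameArr w.axioms), ("witness_mentions_crux", w.mentionsCrux)]

/-! ## The core -/

/-- Core: (human lines, json). Never throws for analysable input; the command still wraps it. -/
def tribunalCore (inp : Inputs) (cfg : Cfg) : TermElabM (Array String × Json) := do
  let t0 ← IO.monoMsNow
  let env ← getEnv
  let b := Budget.ofCfg cfg inp.tier
  let full := b.tier == "full"
  let mut notes : Array String := #[]
  let mut lines : Array String := #[]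
  let tags := allTags env
  -- closes theorem(s) --------------------------------------------------------------------------------------------------
  let closesAll : Array Name := ((tags.filter fun t => t.attr == `closes).map (·.decl)).toList.eraseDups.toArray
  let closesMine : List Name := ((tags.filter fun t => t.attr == `closes && t.arg == inp.rid && env.contains t.decl).map (·.decl)).toList.eraseDups
  let closesThm? : Option Name := match closesMine with | [t] => some t | _ => none
  if closesMine.length > 1 then notes := notes.push s!"several @[closes \"{inp.rid}\"] theorems visible ({closesMine}); binders not read"
  -- summit ---------------------------------------------------------------------------------------------------------------
  if closesThm?.isNone && inp.summit?.isNone then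
    return errorResult inp (if inp.cruxes.isEmpty then s!"no @[closes \"{inp.rid}\"] theorem visible from this file and no `cruxes := […]` / `summit := …` given"
      else s!"`cruxes := […]` without a visible @[closes \"{inp.rid}\"] theorem needs `summit := <Statement>`")
  let (s, summitShown) ← match ← summitExpr env inp.summit? (if inp.summit?.isSome then none else some inp.rid) with
    | .error why => return errorResult inp why
    | .ok r => pure r
  let s ← instantiateMVars s
  let sHead? := headName? s
  let summitFq : String := match sHead? with | some h => h.toString | none => summitShown
  let key? := summitKey? env sHead?
  if key?.isNone then notes := notes.push "summit key underivable (summit head is not `Summit(s).S.P…`): every strong hypothesis is in scope"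
  -- load-bearing cruxes (closes binders that are route items, in order) + `cruxes :=` ------------------------------------
  let isRouteItem (n : Name) : Bool := tags.any fun t => t.attr == `route_item && t.arg == inp.rid && t.decl == n
  let isAnyItem (n : Name) : Bool := tags.any fun t => t.attr == `route_item && t.decl == n
  let mut ladder : Array (String × Option Name × Bool) := #[]      -- (shown binder, head, is route item)
  let mut lb : Array Name := #[]
  if let some ct := closesThm? then
    if let some ci := env.find? ct then
      let bs ← forallTelescope ci.type fun xs _ => do
        let mut out : Array (String × Option Name × Bool × Bool) := #[]
        for x in xs do
          let ld ← x.fvarId!.getDecl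
          let ty ← instantiateMVars ld.type
          let isP ← isProp ty
          let h? := headName? ty
          let item := match h? with | some h => isRouteItem h | none => false
          out := out.push (s!"({ld.userName} : {← ppE ty 80})", h?, item, isP)
        return out
      for (shown, h?, item, isP) in bs do
        ladder := ladder.push (shown, h?, item)
        if isP then
          match h? with
          | some h =>
            if item then
              unless lb.contains h do lb := lb.push h
            else
              notes := notes.push s!"closes binder {shown} is not a @[route_item \"{inp.rid}\"] decl (not load-bearing here)"
          | none => notes := notes.push s!"closes binder {shown} has no head constant"
  for c in inp.cruxes do
    if env.contains c then
      unless lb.contains c do lb := lb.push c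
    else
      notes := notes.push s!"cruxes := {c}: unknown declaration (ignored)"
  if lb.isEmpty then
    return errorResult inp s!"no load-bearing crux: the @[closes \"{inp.rid}\"] theorem has no @[route_item \"{inp.rid}\"] Prop binder and no valid `cruxes := […]` was given"
  -- residual roles (forward mode: the rung — the first load-bearing crux — is the attacked conjunct, the rest of the ladder is residual by construction)
  let residualSet : Array Name := if inp.mode == "forward" && inp.residual.isEmpty then lb.extract 1 lb.size else inp.residual
  for r in residualSet do
    unless lb.contains r do notes := notes.push s!"residual := {r} is not a load-bearing crux of this route (ignored for roles)"
  -- registry: strong hypotheses + bridges in scope -------------------------------------------------------------------------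
  let shTags := (TribunalTags.tagsWithAttr env `strong_hypothesis).filter fun t => env.contains t.decl
  let shInScope : Array Name := ((shTags.filter fun t => match key? with | some k => TribunalTags.keyCovers t.arg k | none => true).map (·.decl)).toList.eraseDups.toArray
  let shAll : Array Name := (shTags.map (·.decl)).toList.eraseDups.toArray
  let shUsed : Array Name := shInScope.extract 0 cfg.maxHyps
  if shInScope.size > cfg.maxHyps then notes := notes.push s!"t1c: {shInScope.size} strong hypotheses in scope, capped at maxHyps={cfg.maxHyps}"
  -- hard-core registry (t1h): `@[hard_core "S" "print"]` decls in scope for this summit, their print names and owners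
  let hcTags := (TribunalTags.tagsWithAttr env `hard_core).filter fun t => env.contains t.decl && (match key? with | some k => TribunalTags.keyCovers t.arg k | none => true)
  let hcInScope : Array Name := (hcTags.map (·.decl)).toList.eraseDups.toArray
  let hcPrint (n : Name) : String := match (TribunalTags.tagsWithAttr env `hard_core_print).find? (·.decl == n) with | some t => t.arg | none => ""
  let hcOwner (n : Name) : Option String := ((TribunalTags.tagsWithAttr env `hard_core_owner).find? (·.decl == n)).map (·.arg)
  let mut runner : Runner := { b, t0 }
  let mut bridges : Array Bridge := #[]
  for t in (TribunalTags.tagsWithAttr env `summit_bridge) do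
    if bridges.any (·.decl == t.decl) then continue
    match env.find? t.decl with
    | some (.thmInfo ti) =>
      let (ok, _, rB) ← runner.declClean t.decl
      runner := rB
      let iff ← forallTelescope ti.type fun _ body => do return (← instantiateMVars body).consumeMData.isAppOf ``Iff
      bridges := bridges.push { decl := t.decl, kind := "landed", key := t.arg, mentions := ti.type.getUsedConstants, clean := ok, isIff := iff }
    | some (.defnInfo di) =>
      -- a printed bridge discharged by a clean `_holds` / `.holds` theorem counts as landed
      let holds? : Option Name := match t.decl with
        | .str p' s' => (if isThm env (.str p' (s' ++ "_holds")) then some (.str p' (s' ++ "_holds")) else if isThm env (.str t.decl "holds") then some (.str t.decl "holds") else none)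
        | _ => none
      let (kind, ok, rB) ← match holds? with
        | some hth => do let (ok, _, rB) ← runner.declClean hth; pure (if ok then "landed" else "printed", ok, rB)
        | none => pure ("printed", true, runner)
      runner := rB
      let iff ← lambdaTelescope di.value fun _ body => do
        forallTelescope (← instantiateMVars body) fun _ b2 => do return b2.consumeMData.isAppOf ``Iff
      bridges := bridges.push { decl := t.decl, kind, key := t.arg, mentions := di.type.getUsedConstants ++ di.value.getUsedConstants, clean := ok, isIff := iff }
    | _ => pure ()
  -- a bridge counts for THIS summit only if its key covers the summit key (OmniToy → KR says nothing about SD)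
  let bridgeHere (br : Bridge) : Bool := match key? with | some k => TribunalTags.keyCovers br.key k | none => true
  let bridgeOf (h : Name) : Option Bridge :=
    (bridges.find? fun br => bridgeHere br && br.mentions.contains h && br.kind == "landed") <|> (bridges.find? fun br => bridgeHere br && br.mentions.contains h)
  -- t1a scan (one pass for all cruxes) ---------------------------------------------------------------------------------------
  let ta ← IO.monoMsNow
  let (hits, scanned) ← try scanConverse env cfg.scanCap lb s sHead? shAll closesAll isAnyItem
    catch e => do notes := notes.push s!"t1a scan failed: {trunc (← e.toMessageData.toString) 200}"; pure (#[], 0)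
  -- decide `clean` per hit through the cached axiom closure (a sorried / postulated `C ↔ S` must neither FAIL an honest route nor pass a forged one)
  let mut hitsClean : Array ScanHit := #[]
  for h in hits do
    let (ok, bad, r0) ← runner.declClean h.decl
    runner := r0
    unless ok do runner := runner.noteUnclean s!"t1a {h.decl} {(bad.toList.take 2)}"
    hitsClean := hitsClean.push { h with clean := ok, bad }
  let hits := hitsClean
  let t1aMs := (← IO.monoMsNow) - ta
  -- per crux -----------------------------------------------------------------------------------------------------------------
  let sUnf : List Name := match sHead? with | some h => unfoldChain env h | none => []
  let nameList (l : List Name) : String := ", ".intercalate (l.eraseDups.map (·.toString))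
  let mut results : Array CruxRes := #[]
  let nLb := lb.size
  let nAttacked := max 1 (lb.filter fun c => !residualSet.contains c).size
  let mut indexWarmMs : Option Nat := none        -- the first `exact?` of a process pays the library index build; charged to no hypothesis
  let hypConsts : Std.HashMap Name (Array Name) := shUsed.foldl (fun m h => m.insert h (declConsts env h)) {}
  let mut cruxIdx := 0
  for c in lb do
    cruxIdx := cruxIdx + 1
    -- a closes binder that is already PROVED (`<C>_holds` landed) is not open: no strength question, never a fail ground (role "proved"; still reported)
    let mut cr : CruxRes := { name := c, role := if holdsProved env c then "proved" else if residualSet.contains c then "residual" else "attacked" }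
    let sibs := lb.filter (· != c)
    cr := { cr with t1aHits := hits.filter (·.crux == c), t1aMs,
                    siblingsProved := closesThm?.isSome && sibs.all (fun o => holdsProved env o) }
    -- the crux as a closed Prop constant
    let lvls : List Name := match env.find? c with | some ci => ci.levelParams | none => []
    let ce := mkConst c (lvls.map Level.param)
    let closedProp : Bool ← try (if (env.find? c).isNone then pure false else isProp ce) catch _ => pure false
    unless closedProp do
      cr := { cr with closed := false, note := (if isThm env c then s!"{short c} is a theorem (already proved), not a crux" else s!"{short c} is not a closed Prop constant (parameters?): t1b/t1c skipped") }
      results := results.push cr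
      continue
    if isThm env c then cr := { cr with note := s!"{short c} is already a THEOREM visible from this file (proved crux / ledger drift): probed as stated" }
    let cUnf := unfoldChain env c
    let cU := nameList (if cUnf.isEmpty then [c] else cUnf)
    let unfolds := nameList ((if cUnf.isEmpty then [c] else cUnf) ++ sUnf)
    -- t1c -------------------------------------------------------------------------------------------------------------------
    -- this crux's SHARE of the remaining command budget (cruxes still to probe divide what is left); t1c gets it first
    let tc ← IO.monoMsNow
    let remainingCruxes := max 1 (nLb + 1 - cruxIdx)
    let share := if runner.deadline > tc then (runner.deadline - tc) / remainingCruxes else 0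
    let shareEnd := tc + share
    -- clause budget: full = max(25 s, 55 % of the nominal total / #attacked cruxes) capped by the share; quick = 45 % of the share
    -- t-carrier (cheap, kernel-certified when it fires): DATA binders of the crux statement over project types — inhabited / EMPTY / trivial
    let tcT ← IO.monoMsNow
    let tcCap := if full then 30000 else 10000
    let tcDeadline := tcT + min tcCap (share * 25 / 100)
    let tcCfg : CarrierProbe.Cfg := { goalMs := (if full then 5000 else 1500), librarySearch := full, cheapHeartbeats := min b.cheapHeartbeats 40000, heartbeats := b.heartbeats }
    let stmtE : Except String (Expr × List Name) ← try cruxStatement env c catch _ => pure (.error "cruxStatement failed")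
    match stmtE with
    | .ok (stmt, _) =>
      let rows ← try CarrierProbe.probeStatementCarriers env tcCfg stmt tcDeadline
        catch e => do pure #[{ carrier := "statement", shown := "", status := "error", note := s!"carrier probe threw: {trunc (← e.toMessageData.toString) 120}" }]
      cr := { cr with tcRows := rows, tcRan := true, tcMs := (← IO.monoMsNow) - tcT }
    | .error why => cr := { cr with tcRan := false, tcNote := why, tcMs := (← IO.monoMsNow) - tcT }
    let tc ← IO.monoMsNow
    let share := if shareEnd > tc then shareEnd - tc else 0
    let clauseBudget := if full then min share (max 25000 ((b.totalMs * 55 / 100) / nAttacked)) else share * 45 / 100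
    let clauseDeadline := tc + clauseBudget
    cr := { cr with t1cInScope := shInScope.size, t1cBudgetMs := clauseBudget }
    if shUsed.isEmpty then
      cr := { cr with t1cVerdict := "skipped", t1cMs := 0 }
      if shAll.isEmpty then notes := notes.push "t1c: no @[strong_hypothesis] decl visible from this file (import Literature/StrongHypotheses/<S>.lean)"
    else
      -- RELEVANCE ORDER: hypotheses sharing constants with the crux first (ties: bridge landed > printed > none, then registry order)
      let cConsts : Std.HashSet Name := (declConsts env c).foldl (fun acc n => acc.insert n) {}
      let bkRank (bk : String) : Nat := if bk == "landed" then 0 else if bk == "printed" then 1 else 2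
      let mut scored : Array (Name × String × Option Name × Bool × Nat × Nat) := #[]      -- (H, bridge kind, bridge, bridge clean, overlap, registry index)
      let mut idx := 0
      for h in shUsed do
        let br? := bridgeOf h
        let bk := match br? with | some br => br.kind | none => "none"
        scored := scored.push (h, bk, br?.map (·.decl), (match br? with | some br => br.clean | none => true), relevance env cConsts (hypConsts.getD h #[]), idx)
        idx := idx + 1
      let ordered := scored.qsort fun (_, bk1, _, _, o1, i1) (_, bk2, _, _, o2, i2) =>
        o1 > o2 || (o1 == o2 && (bkRank bk1 < bkRank bk2 || (bkRank bk1 == bkRank bk2 && i1 < i2)))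
      -- structural candidates: landed project theorems concluding C (t1a scan), clean, ≤ 8
      let structural := ((cr.t1aHits.filter fun x => x.clean && (x.kind.startsWith "implies-crux" || x.kind.startsWith "hypothesis-implies-crux")).map (·.decl)).extract 0 8
      cr := { cr with t1cStructural := structural.size }
      let mut tried : Array HypTry := #[]
      let mut cutAny := false
      let mut skippedIrrelevant := 0
      -- plans in rank order
      let mut plans : Array (Name × HypTry × String × Array (String × Expr)) := #[]    -- (H, record template, hU, goals)
      let mut rank := 0
      for (h, bk, brd?, bclean, ov, _) in ordered do
        rank := rank + 1
        let base : HypTry := { hyp := h, bridgeKind := bk, bridge? := brd?, bridgeClean := bclean, outcome := "open", rank, overlap := ov }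
        if h == c then
          tried := tried.push { base with outcome := "skipped:the crux IS the registered strong hypothesis" }
          continue
        if !full && ov == 0 && bk == "none" then
          skippedIrrelevant := skippedIrrelevant + 1
          tried := tried.push { base with outcome := "skipped-irrelevant" }
          continue
        let hU := nameList (let u := unfoldChain env h; if u.isEmpty then [h] else u)
        let hl : List Name := match env.find? h with | some ci => ci.levelParams | none => []
        let he := mkConst h (hl.map Level.param)
        let mut goals : Array (String × Expr) := #[]
        let heProp : Bool ← try isProp he catch _ => pure false
        if heProp then goals := goals.push ("H→C", ← mkArrow he ce)
        let hsE : Except String (Expr × List Name) ← try cruxStatement env h catch _ => pure (.error "cruxStatement failed")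
        match hsE with
        | .ok (hs, _) => goals := goals.push ("H⁎→C", ← mkArrow hs ce)
        | .error why => if goals.isEmpty then tried := tried.push { base with outcome := s!"skipped:{why}" }
        if goals.isEmpty then continue
        plans := plans.push (h, base, hU, goals)
      -- PASS A: identity-by-delta + structural shortcuts for EVERY planned hypothesis (milliseconds each; `H → C`, low heartbeat cap);
      -- PASS S: the cheap normalising portfolio in rank order, small per-goal cap; PASS B (tier full): library search on `H → C` in rank
      -- order while the clause budget lasts (index warmed first, charged to nobody). A hypothesis with a bridge that did not complete every
      -- pass of the tier makes the clause `t1c-timeout`-ambiguous (a kernel FAIL is final and a PASS skips the judge: coverage must be known).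
      let capA := 1500
      let hbA := min b.cheapHeartbeats 2000          -- pass A is delta / structural: a verbatim match closes in milliseconds; never let unification grind
      let capS := if full then 2500 else 1200
      let capB := 15000
      let mut state : Std.HashMap Name HypTry := {}
      let mut cutAfterRank : Option Nat := none
      let mut effDeadline := clauseDeadline
      for ps in ["A", "S", "B"] do
        if ps == "B" then
          if !full then break
          if (plans.any fun (h, _, _, _) => match state.get? h with | some p => !p.fired | none => true) && indexWarmMs.isNone then
            -- warm the library index on a goal `solve_by_elim` cannot close (so `exact?` really builds it); charge it to nobody:
            -- the clause deadline and the command's total deadline both shift by the warm-up time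
            let tw ← IO.monoMsNow
            let warmGoal? ← (try elabTemplate "∀ a b : Nat, a + b = b + a" #[] catch _ => pure none)
            match warmGoal? with
            | some warm => do let _ ← tryTacticOn warm "exact?" b.heartbeats; pure ()
            | none => pure ()
            let wms := (← IO.monoMsNow) - tw
            indexWarmMs := some wms
            effDeadline := effDeadline + wms
            runner := { runner with t0 := runner.t0 + wms }
        for (h, base, hU, goals) in plans do
          if let some prev := state.get? h then
            if prev.fired then continue
          if (← IO.monoMsNow) > effDeadline || (← IO.monoMsNow) > runner.deadline then
            cutAny := true
            if cutAfterRank.isNone then cutAfterRank := some (base.rank - 1)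
            unless state.contains h do state := state.insert h { base with outcome := "cut" }
            continue
          let tacs := if ps == "A" then strongHypDefeqTactics structural else if ps == "S" then strongHypCheapTactics cU hU structural else strongHypLSTactics hU
          let gs := if ps == "S" then goals else goals.extract 0 1     -- A / B on `H → C` only (delta sees the definiens anyway)
          let cap := if ps == "A" then capA else if ps == "S" then capS else capB
          let th ← IO.monoMsNow
          let mut outcome := "open"
          let mut firedTac := ""
          let mut firedMs := 0
          let mut uses : Array Name := #[]
          let mut wasCut := false
          for (gl, g) in gs do
            let (gr, r3) ← runGoal runner s!"t1c:{short c}<={short h}:{gl}:{ps}" g tacs closesAll (budgetMs := cap) (clauseDeadline := effDeadline)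
              (hb := if ps == "A" then hbA else 0)
            runner := r3
            if gr.closed then
              outcome := "fired"; firedTac := (if gl == "H→C" then gr.tactic else gr.tactic ++ "  [on H's definiens]"); firedMs := gr.ms; uses := gr.usesProject
              break
            unless gr.cut.isEmpty do
              outcome := "cut"; cutAny := true; wasCut := true
              if cutAfterRank.isNone then cutAfterRank := some (base.rank - 1)
          let hMs := (← IO.monoMsNow) - th
          let prev? := state.get? h
          let prevMs := match prev? with | some p => p.ms | none => 0
          let prevPhases := match prev? with | some p => p.phases | none => ""
          let phaseV := if outcome == "fired" then ps else ""
          let phasesV := if wasCut then prevPhases else prevPhases ++ ps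
          let msV := if outcome == "fired" then firedMs else prevMs + hMs
          let rec_ : HypTry := { base with outcome := outcome, tactic := firedTac, phase := phaseV, phases := phasesV, ms := msV, usesProject := uses }
          state := state.insert h rec_
      for (h, base, _, _) in plans do
        tried := tried.push ((state.get? h).getD { base with outcome := "cut" })
      -- DEGENERACY GUARD for rule (a): a fired hypothesis with a landed bridge that is itself IMPLIED BY the summit (S → H closes cheaply) is summit-EQUIVALENT,
      -- so `H → C` is only `S → C` — converse-only, not summit-strength. (Cheap portfolio, no library search; misses deep equivalences, catches restatements.)
      -- CONTROL: does the crux close WITHOUT any hypothesis (already proved in the visible tree / cheap tautology)? Then every `H → C` fire is trivial.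
      let mut cruxProv := false
      let mut cruxProvBy := ""
      if tried.any (fun t => t.fired && t.bridgeKind == "landed") then
        let ctlTacs : Array String := #["exact?", "simp_all", "aesop", "decide", "tauto"].filter fun tt => full || !isLS tt
        let (gc, rgc) ← runGoal runner s!"t1c-control:{short c}:⊢C" ce ctlTacs closesAll (budgetMs := max 1 (3 * b.perGoalMs))
        runner := rgc
        if gc.closed then cruxProv := true; cruxProvBy := gc.tactic ++ (if gc.usesProject.isEmpty then "" else s!" using {(gc.usesProject.toList.take 2)}")
      let mut guarded : Array HypTry := #[]
      for t in tried do
        if t.fired && t.bridgeKind == "landed" && cruxProv then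
          guarded := guarded.push { t with cruxProvable := true, cruxProvableBy := cruxProvBy }
          continue
        if t.fired && t.bridgeKind == "landed" then
          -- (i) the registered bridge is itself an equivalence (criterion): H ≡ summit by construction
          if let some bd := t.bridge? then
            if (bridges.find? (·.decl == bd)).any (·.isIff) then
              guarded := guarded.push { t with restatesSummit := true, restatesBy := s!"registered bridge {short bd} is an equivalence (criterion ↔ summit)" }
              continue
          let hl : List Name := match env.find? t.hyp with | some ci => ci.levelParams | none => []
          let he := mkConst t.hyp (hl.map Level.param)
          let hUnf := nameList (let u := unfoldChain env t.hyp; if u.isEmpty then [t.hyp] else u)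
          let gTacs := ((summitTactics (unfolds ++ ", " ++ hUnf)).filter fun tt => !isLS tt)
          let mut restates := false
          let mut rby := ""
          let heProp : Bool ← try isProp he catch _ => pure false
          if heProp then
            let (g1, rg1) ← runGoal runner s!"t1c-guard:{short c}:S→{short t.hyp}" (← mkArrow s he) gTacs closesAll (budgetMs := max 1 (2 * b.perGoalMs))
            runner := rg1
            if g1.closed then restates := true; rby := g1.tactic
          unless restates do
            let hsE : Except String (Expr × List Name) ← try cruxStatement env t.hyp catch _ => pure (.error "-")
            if let .ok (hs, _) := hsE then
              let (g2, rg2) ← runGoal runner s!"t1c-guard:{short c}:S→{short t.hyp}⁎" (← mkArrow s hs) gTacs closesAll (budgetMs := max 1 (2 * b.perGoalMs))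
              runner := rg2
              if g2.closed then restates := true; rby := g2.tactic ++ "  [on H's definiens]"
          guarded := guarded.push { t with restatesSummit := restates, restatesBy := rby }
        else guarded := guarded.push t
      tried := guarded
      tried := tried.qsort fun a b => a.rank < b.rank
      let firedAny := tried.any (·.fired)
      cr := { cr with t1cTried := tried, t1cVerdict := (if firedAny then "fired" else if cutAny then "timeout" else "clean"),
                      t1cCutAfterRank := cutAfterRank, t1cSkippedIrrelevant := skippedIrrelevant }
    cr := { cr with t1cMs := (← IO.monoMsNow) - tc }
    -- t1h HARD-CORE (F1): C tagged itself, or cheap `C → HC` / `HC → C`, or a landed clean theorem relating them (from the t1a scan hits) -----------------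
    let th ← IO.monoMsNow
    -- t1h has its OWN small budget (the crux share is usually spent by t1c): ≤ 12 cores × 2 cheap goals
    let hcDeadline := th + (if full then 60000 else 20000)
    let mut hch : Array HcHit := #[]
    if hcInScope.contains c then
      hch := hch.push { core := c, print := hcPrint c, direction := "tagged-self", owner? := hcOwner c }
    for hc in hcInScope do
      if hc == c then continue
      if (← IO.monoMsNow) > hcDeadline then break
      let hl : List Name := match env.find? hc with | some ci => ci.levelParams | none => []
      let hce := mkConst hc (hl.map Level.param)
      let hcProp : Bool ← try isProp hce catch _ => pure false
      unless hcProp do continue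
      let hU := nameList (let u := unfoldChain env hc; if u.isEmpty then [hc] else u)
      let tacs := spTactics ++ ((summitTactics (unfolds ++ ", " ++ hU)).filter fun t => !isLS t)   -- instant structural tactics FIRST (aesop eats the budget)
      -- goals on the DEFINIENS of both sides (projections / instantiations need the unfolded statements), constants as fallback
      let cS : Expr ← (do match ← cruxStatement env c with | .ok (e, _) => pure e | .error _ => pure ce)
      let hS : Expr ← (do match ← cruxStatement env hc with | .ok (e, _) => pure e | .error _ => pure hce)
      let (g1, rh1) ← runGoal runner s!"t1h:{short c}→{short hc}" (← mkArrow cS hS) tacs closesAll (budgetMs := max 1 b.perGoalMs)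
      runner := rh1
      cr := { cr with hcTried := cr.hcTried.push (s!"{short c}→{short hc}: " ++ ", ".intercalate ((g1.tries.extract 0 14).toList.map fun t => s!"[{t.tactic.take 30}… {t.outcome.take 60}]")) }
      if g1.closed then
        hch := hch.push { core := hc, print := hcPrint hc, direction := "c-implies-core", by_ := g1.tactic, ms := g1.ms, owner? := hcOwner hc }
        continue
      let (g2, rh2) ← runGoal runner s!"t1h:{short hc}→{short c}" (← mkArrow hS cS) tacs closesAll (budgetMs := max 1 b.perGoalMs)
      runner := rh2
      if g2.closed then
        hch := hch.push { core := hc, print := hcPrint hc, direction := "core-implies-c", by_ := g2.tactic, ms := g2.ms, owner? := hcOwner hc }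
        continue
      -- landed relation in the scan hits (t1a recorded `iff-other:<X>` / `implies-crux` kinds; match by the core's short name)
      match cr.t1aHits.find? (fun x => x.clean && (x.kind == s!"iff-other:{short hc}" || x.kind == s!"iff-hypothesis:{short hc}" || x.kind == s!"hypothesis-implies-crux:{short hc}")) with
      | some x => hch := hch.push { core := hc, print := hcPrint hc, direction := (if x.kind.startsWith "iff" then "iff-landed" else "implies-landed"), by_ := x.decl.toString, owner? := hcOwner hc }
      | none => pure ()
    cr := { cr with hcHits := hch, hcInScope := hcInScope.size, hcMs := (← IO.monoMsNow) - th, hcTried := cr.hcTried }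
    -- t1b (after t1c: the decisive clause is protected from the summit tactics' cost; budgets from what is left of this crux's share) --------
    let tb ← IO.monoMsNow
    let rest := if shareEnd > tb then shareEnd - tb else 0
    let upBudget := max 1 (min (if full then 4 * b.perGoalMs else 3 * b.perGoalMs) (rest * 60 / 100))
    let dnBudget := max 1 (min (3 * b.perGoalMs) (rest * 40 / 100))
    let upTacs := (summitTactics unfolds).filter fun t => full || !isLS t
    let (up, r1) ← runGoal runner s!"t1b:{short c}:C→S" (← mkArrow ce s) upTacs closesAll (budgetMs := upBudget)
    runner := r1
    let dnTacs := ((summitTactics unfolds).filter fun t => !isLS t) ++ spTactics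
    let (dn, r2) ← runGoal runner s!"t1b:{short c}:S→C" (← mkArrow s ce) dnTacs closesAll (budgetMs := dnBudget)
    runner := r2
    cr := { cr with cToS := up, sToC := dn, t1bMs := (← IO.monoMsNow) - tb }
    results := results.push cr
  -- t-carrier on the SUMMIT statement's own binders (informational: an empty summit carrier is an operator matter, not the route's) ---------
  let tsT ← IO.monoMsNow
  let summitRows : Array CarrierProbe.Row ← (do
      let tcCfgS : CarrierProbe.Cfg := { goalMs := (if full then 5000 else 1500), librarySearch := full, cheapHeartbeats := min b.cheapHeartbeats 40000, heartbeats := b.heartbeats }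
      try CarrierProbe.probeStatementCarriers env tcCfgS s (tsT + (if full then 20000 else 6000))
      catch e => do pure #[{ carrier := "summit", shown := "", status := "error", note := s!"carrier probe threw: {trunc (← e.toMessageData.toString) 120}" }])
  let summitTcJ := Json.mkObj [("rows", Json.arr (summitRows.map (·.toJson))), ("empty", strArr ((summitRows.filter (·.status == "empty")).map (·.carrier))),
    ("unknown", strArr ((summitRows.filter fun r => r.status == "unknown" || r.status == "error").map (·.carrier))), ("ms", ((← IO.monoMsNow) - tsT : Nat))]
  -- t1r joint / residual --------------------------------------------------------------------------------------------------------
  let joint := results.size ≥ 2 && results.all (·.sImpliesC)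
  let residualDeclared := residualSet.any fun r => lb.contains r
  let t1rVerdict := if !joint then "not-joint" else if residualDeclared then "joint-declared" else "joint-unassigned"
  results := results.map fun cr => { cr with t1r := t1rVerdict }
  -- t3k witness (route level; forward: the floor doubles as the witness) ----------------------------------------------------------
  let attacked? : Option Name := (results.find? fun cr => cr.role == "attacked").map (·.name)
  let witnessName? := inp.witness? <|> (if inp.mode == "forward" then inp.floor? else none)
  let wBad : Array Name ← match witnessName? with
    | some w => do
      if (env.find? w).isSome then
        let (ok, bad, r8) ← runner.declClean w
        runner := r8
        unless ok do runner := runner.noteUnclean s!"witness {w} {(bad.toList.take 2)}"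
        pure bad
      else pure #[]
    | none => pure #[]
  let wi ← witnessInfo env witnessName? attacked? wBad
  -- s_case
  let mut sCaseJ : Json := Json.mkObj [("given", Json.null), ("found", false)]
  let mut sCaseFound := false
  let mut sCaseBy : String := ""
  if let some x := inp.sCase? then
    match env.find? x with
    | none => sCaseJ := Json.mkObj [("given", x.toString), ("found", false), ("error", "unknown declaration")]
    | some (.thmInfo _) =>
      let (clean, badX, r9) ← runner.declClean x
      runner := r9
      unless clean do runner := runner.noteUnclean s!"s_case {x} {(badX.toList.take 2)}"
      sCaseFound := clean; sCaseBy := s!"theorem {x}"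
      sCaseJ := Json.mkObj [("given", x.toString), ("found", clean), ("by", "theorem"), ("decl_used", x.toString), ("clean", clean)]
    | some _ =>
      let xsE : Except String (Expr × List Name) ← try cruxStatement env x catch _ => pure (.error "not analysable")
      match xsE with
      | .error why => sCaseJ := Json.mkObj [("given", x.toString), ("found", false), ("error", why)]
      | .ok (g, _) =>
        let (gr, r4) ← runGoal runner s!"t3k:s_case:{short x}" g (sCaseTactics full) closesAll (budgetMs := 2 * b.perGoalMs)
        runner := r4
        sCaseFound := gr.closed; sCaseBy := gr.tactic
        sCaseJ := Json.mkObj [("given", x.toString), ("found", gr.closed), ("by", if gr.closed then Json.str gr.tactic else Json.null),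
          ("decl_used", nameArr gr.usesProject), ("attempts", Json.arr (gr.tries.map (·.toJson)))]
  -- t4 method family ---------------------------------------------------------------------------------------------------------------
  let mfTags := TribunalTags.tagsWithAttr env `method_family
  let ownFamily : List String := match closesThm? with
    | some ct => (mfTags.filter (·.decl == ct)).toList.foldl (fun acc t => acc ++ tokensOf t.arg) []
    | none => []
  let famTokens : List String := (tokensOf inp.family ++ ownFamily).eraseDups
  let need := if famTokens.length ≤ 2 then 1 else 2
  let mut matched : Array Json := #[]
  let mut matchedNames : Array Name := #[]
  unless famTokens.isEmpty do
    for t in mfTags do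
      if some t.decl == closesThm? then continue
      if matchedNames.contains t.decl then continue
      let toks := tokensOf t.arg
      let overlap := toks.filter famTokens.contains
      if overlap.length ≥ need then
        matchedNames := matchedNames.push t.decl
        matched := matched.push (Json.mkObj [("decl", t.decl.toString), ("tokens", strArr toks.toArray), ("overlap", strArr overlap.toArray),
          ("module", optName ((env.getModuleIdxFor? t.decl).bind fun i => moduleName? env i.toNat))])
  let t4Verdict := if famTokens.isEmpty then "no-family" else if matched.isEmpty then "unmatched" else "matched"
  let t4J := Json.mkObj [("verdict", t4Verdict), ("family_tokens", strArr famTokens.toArray), ("matched", Json.arr matched),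
    ("registry_size", mfTags.size), ("note", "technique_class: docstring blocks of Literature/Barriers are matched by the Python CLI, not by the kernel")]
  -- forward mode -----------------------------------------------------------------------------------------------------------------------
  let mut forwardJ : Json := Json.null
  let mut fwRealStep := true
  let mut fwShape? : Option String := none
  let mut fwOnPath := true
  let mut fwSameBy : String := ""
  let mut fwRan := false
  if inp.mode == "forward" then
    let rung := lb[0]!
    let rungRes? := results.find? (·.name == rung)
    fwOnPath := match rungRes? with | some cr => cr.sImpliesC | none => false
    let rungFirst := match ladder[0]? with | some (_, h?, _) => h? == some rung | none => (inp.cruxes[0]? == some rung)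
    let ladderJ := Json.mkObj [("binders", Json.arr (ladder.map fun (shown, h?, item) => Json.mkObj [("binder", shown), ("head", optName h?), ("route_item", item)])),
      ("rung_first", rungFirst)]
    match inp.floor? with
    | none =>
      notes := notes.push "forward mode without `floor := <theorem>`: real_step / specialises not measured"
      forwardJ := Json.mkObj [("floor", Json.null), ("rung", rung.toString), ("on_path", fwOnPath), ("real_step", Json.null), ("same_rung_by", Json.null),
        ("specialises", Json.null), ("ladder", ladderJ), ("witness_clean", false)]
    | some f =>
      match env.find? f with
      | some (.thmInfo fi) =>
        fwRan := true
        let rl : List Name := match env.find? rung with | some ci => ci.levelParams | none => []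
        let re := mkConst rung (rl.map Level.param)
        let rU := nameList (let u := unfoldChain env rung; if u.isEmpty then [rung] else u)
        let okProp : Bool ← try isProp re catch _ => pure false
        if okProp then
          let ftype ← instantiateMVars fi.type
          let (g1, r5) ← runGoal runner s!"forward:F→Rung" (← mkArrow ftype re) (sameRungTactics rU f) closesAll (budgetMs := 3 * b.perGoalMs)
          runner := r5
          let (g2, r6) ← runGoal runner s!"forward:Rung" re (sameRungTactics rU f) closesAll (budgetMs := 3 * b.perGoalMs)
          runner := r6
          let (g3, r7) ← runGoal runner s!"forward:Rung→F" (← mkArrow re ftype) (specialiseTactics rU) closesAll (budgetMs := 2 * b.perGoalMs)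
          runner := r7
          fwRealStep := !(g1.closed || g2.closed)
          fwSameBy := if g1.closed then s!"Ftype → Rung by `{g1.tactic}`" else if g2.closed then s!"Rung outright by `{g2.tactic}`" else ""
          -- F3 quantifier shape: is the rung merely `P n₀` / a finite truncation of the summit's leading ∀ ?
          fwShape? := (← try instantiationShape env s re catch _ => pure none)
          forwardJ := Json.mkObj [("floor", f.toString), ("floor_type", (← ppE ftype 200)), ("rung", rung.toString), ("on_path", fwOnPath),
            ("real_step", fwRealStep), ("same_rung_by", if fwRealStep then Json.null else Json.str fwSameBy),
            ("floor_implies_rung", g1.toJson), ("rung_outright", g2.toJson), ("specialises", g3.closed), ("rung_implies_floor", g3.toJson),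
            ("instantiation", match fwShape? with | some w => (w : Json) | none => Json.null), ("transfer", optName inp.transfer?), ("ladder_type_hint", (if fwShape?.isSome && inp.transfer?.isNone then "III/IV-candidate" else "" : String)),
            ("ladder", ladderJ), ("witness_clean", wi.clean && wi.given == some f || (inp.witness?.isSome && wi.clean))]
        else
          notes := notes.push s!"forward: rung {rung} is not a closed Prop constant; real_step not measured"
          forwardJ := Json.mkObj [("floor", f.toString), ("rung", rung.toString), ("on_path", fwOnPath), ("real_step", Json.null), ("ladder", ladderJ), ("witness_clean", wi.clean)]
      | some _ =>
        notes := notes.push s!"forward: floor {f} is not a theorem"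
        forwardJ := Json.mkObj [("floor", f.toString), ("rung", rung.toString), ("on_path", fwOnPath), ("real_step", Json.null), ("error", "floor is not a theorem"), ("ladder", ladderJ), ("witness_clean", false)]
      | none =>
        notes := notes.push s!"forward: unknown floor declaration {f}"
        forwardJ := Json.mkObj [("floor", f.toString), ("rung", rung.toString), ("on_path", fwOnPath), ("real_step", Json.null), ("error", "unknown floor"), ("ladder", ladderJ), ("witness_clean", false)]
  -- verdict (D-0033 §2b: the kernel check is the default path; a kernel FAIL is FINAL, so it is issued on kernel-CERTIFIED grounds only) ------------
  let mut reasons : Array String := #[]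
  let mut feedback : Array String := #[]
  let mut chips : Array String := literatureChips
  let mut failGrounds : Array String := #[]
  let mut ambiguity : Array String := #[]
  let witnessOk := wi.verdict == "present"                                   -- present ⇒ clean (witnessInfo)
  let sCaseGiven := inp.sCase?.isSome
  let regimeOk := inp.mode == "forward" || (sCaseGiven && !sCaseFound)      -- the witness sits OUTSIDE the summit's known regime (forward: the floor is the regime marker)
  let separating := witnessOk && regimeOk
  let mut ruleDOpen := false
  let mut ruleDExempt := false
  for cr in results do
    let attacked := cr.role == "attacked"
    if cr.role == "proved" then reasons := reasons.push s!"binder-proved:{short cr.name}"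
    for r in cr.tcEmpty do
      reasons := reasons.push s!"empty-carrier:{short cr.name}:{r.carrier}"
      failGrounds := failGrounds.push s!"empty-carrier:{short cr.name}:{r.carrier}"
      feedback := feedback.push s!"crux {short cr.name} quantifies over {trunc r.shown 90}, which is provably EMPTY (`{r.by_}`): every statement over it is vacuous — re-type the carrier"
    for r in cr.tcUnknown do
      if full then
        ambiguity := ambiguity.push s!"carrier-unverified:{short cr.name}:{r.carrier}"
      else
        unless chips.contains "carrier-unverified" do chips := chips.push "carrier-unverified"
      reasons := reasons.push s!"carrier-unverified:{short cr.name}:{r.carrier}"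
    for r in cr.tcTrivial do
      reasons := reasons.push s!"trivial-carrier:{short cr.name}:{r.carrier}"
      feedback := feedback.push s!"crux {short cr.name}: carrier {trunc r.shown 90} is a SUBSINGLETON (`{r.trivialBy}`): a statement over a one-point type is usually degenerate — check the typing"
    for h in cr.hcHits do
      let mine := match h.owner? with | some o => o == inp.rid | none => false
      reasons := reasons.push s!"t1h:{short cr.name}:{h.direction}:{short h.core}{if mine then ":owner" else ""}"
      if attacked && !mine then
        unless ambiguity.contains s!"hard-core:{short h.core}" do ambiguity := ambiguity.push s!"hard-core:{short h.core}"
        feedback := feedback.push s!"{short cr.name} meets the registered HARD CORE {short h.core}{if h.print.isEmpty then "" else s!" ({h.print})"} — {h.direction}{if h.by_.isEmpty then "" else s!" via `{h.by_}`"}: a famous open sub-problem; not a fail, but the route belongs on the FRONTIER shelf unless it is the core's owner (refuters/strategists/ladders only)"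
    for h in cr.t1aDecisive do
      reasons := reasons.push s!"t1a:{short cr.name}<->{h.kind}:{short h.decl}"
      if attacked then failGrounds := failGrounds.push s!"t1a:{h.kind}:{short cr.name}:{h.decl}"
      feedback := feedback.push (if h.kind == "iff-summit"
        then s!"{short cr.name} ↔ summit is landed ({h.decl}): this is a criterion, not a reduction — re-target at a strictly weaker sub-crux or bank it as a criterion"
        else s!"summit → {short cr.name} is landed ({h.decl}) and the route proves {short cr.name} → summit: {short cr.name} is summit-equivalent — re-target")
    for h in cr.t1aConverseOnly do
      reasons := reasons.push s!"t1a-converse-only:{short cr.name}:{short h.decl}"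
      if attacked then
        ambiguity := ambiguity.push s!"converse-only:{short cr.name}:{short h.decl}"
        feedback := feedback.push s!"summit → {short cr.name} is landed ({h.decl}) but {short cr.name} → summit is NOT certified (siblings open, no landed C → S, C → S does not close cheaply): {short cr.name} is a CONSEQUENCE of the summit — summit-strength only if the route's other cruxes get proved; a genuine reduction otherwise"
    for h in cr.t1cFired do
      if h.decisive then
        reasons := reasons.push s!"t1c:{short cr.name}<={short h.hyp}"
        if attacked then failGrounds := failGrounds.push s!"t1c:landed-bridge:{short cr.name}<={h.hyp}"
        feedback := feedback.push s!"{short cr.name} follows from registered strong hypothesis {short h.hyp} (bridge LANDED: {(h.bridge?.map (·.toString)).getD "-"}) by `{h.tactic}`{if h.usesProject.isEmpty then "" else s!" using {(h.usesProject.toList.take 3)}"} in {h.ms} ms — summit-strength by rule (a), kernel-certified: drop or split this crux, or exhibit a separating witness"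
      else if h.cruxProvable then
        reasons := reasons.push s!"t1c-degenerate:crux-provable:{short cr.name}"
        feedback := feedback.push s!"{short cr.name} closes OUTRIGHT (`{h.cruxProvableBy}`) — it is already proved / provable in the visible tree, so `{short h.hyp} → {short cr.name}` is trivial and rule (a) says nothing; if {short cr.name} is a proved binder it should not be load-bearing"
      else if h.restatesSummit then
        reasons := reasons.push s!"t1c-restates-summit:{short cr.name}<={short h.hyp}"
        if attacked then ambiguity := ambiguity.push s!"hypothesis-equivalent-to-summit:{short h.hyp}"
        feedback := feedback.push s!"{short cr.name} follows from registered hypothesis {short h.hyp} by `{h.tactic}`, but summit → {short h.hyp} ALSO closes (`{h.restatesBy}`): {short h.hyp} is summit-equivalent, so this is only summit → {short cr.name} (converse-only) — rule (a) certifies nothing here; the seats decide"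
      else if h.bridgeKind == "printed" || (h.bridgeKind == "landed" && !h.bridgeClean) then
        reasons := reasons.push s!"t1c-printed:{short cr.name}<={short h.hyp}"
        if attacked then ambiguity := ambiguity.push s!"printed-bridge:{short h.hyp}"
        feedback := feedback.push s!"{short cr.name} follows from registered strong hypothesis {short h.hyp} by `{h.tactic}` in {h.ms} ms, but the bridge {short h.hyp} → summit is only PRINTED ({(h.bridge?.map (·.toString)).getD "-"}{if h.bridgeKind == "landed" then ", discharge not axiom-clean" else ""}): land the bridge to certify rule (a), or the seats decide"
      else
        reasons := reasons.push s!"t1c-nobridge:{short cr.name}<={short h.hyp}"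
        if attacked then ambiguity := ambiguity.push s!"unbridged-hypothesis:{short h.hyp}"
        feedback := feedback.push s!"{short cr.name} follows from {short h.hyp} by `{h.tactic}` but no @[summit_bridge] for {short h.hyp} is registered: register the bridge (landed or printed) or argue {short h.hyp} ⇏ summit"
    -- t1c coverage: a bridged hypothesis that did not complete every pass of the tier
    let wantPhases := if full then "ASB" else "AS"
    let uncovered := cr.t1cTried.filter fun h => h.bridgeKind != "none" && !h.fired && !(h.outcome.startsWith "skipped") && h.phases != wantPhases
    if attacked && !uncovered.isEmpty && cr.t1cFired.isEmpty then
      unless ambiguity.contains "t1c-timeout" do ambiguity := ambiguity.push "t1c-timeout"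
      reasons := reasons.push s!"t1c:timeout:{short cr.name}:{uncovered.size}-bridged-hypotheses-uncovered"
    if cr.ruleD then
      if inp.mode == "forward" then
        reasons := reasons.push s!"t1b:c-implies-s:{short cr.name}"      -- expected of a rung's ladder; informational in forward mode
      else if cr.via.isSome || !attacked then
        reasons := reasons.push s!"t1b:rule-d-premise:{short cr.name}"
      else
        -- human ruling 2026-08-17: a certified strict strengthening is never `eligible`; with a separating witness it is `provisional-frontier`
        ruleDOpen := true
        if separating then
          ruleDExempt := true
          reasons := reasons.push s!"t1b:rule-d-exempt:{short cr.name}"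
          ambiguity := ambiguity.push s!"rule-d-exempt:{short cr.name}"
          feedback := feedback.push s!"{short cr.name} → summit closes by `{cr.cToS.tactic}` and summit → {short cr.name} does not (certified strict strengthening, rule (d)); the separating witness {(wi.given.map (·.toString)).getD "?"} exempts it from summit strength but the route is FRONTIER: seat a refutation of {short cr.name} as a distinct conjecture first"
        else
          reasons := reasons.push s!"t1b:rule-d-premise:{short cr.name}"
          ambiguity := ambiguity.push s!"rule-d-claim:{short cr.name}"
          feedback := feedback.push (if witnessOk && sCaseFound
            then s!"{short cr.name} → summit closes by `{cr.cToS.tactic}` (rule (d) premise) and the witness sits INSIDE the summit's known regime (s_case {(inp.sCase?.map short).getD ""} is provable): exhibit a rung of {short cr.name} where the summit is open"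
            else if witnessOk then s!"{short cr.name} → summit closes by `{cr.cToS.tactic}` (rule (d) premise); the witness is given but no `s_case := <the S-restricted case>` shows it lies outside the summit's known regime"
            else s!"{short cr.name} → summit closes by `{cr.cToS.tactic}` (rule (d) premise) and no separating witness is given: pass `witness := <a proved rung of {short cr.name} outside the summit's known regime>` and `s_case := …`")
    for h in cr.t1aHits do
      unless h.decisive do
        if !h.clean then
          reasons := reasons.push s!"t1a-unclean:{short cr.name}:{h.kind}:{short h.decl}"
          if h.kind == "iff-summit" || h.kind == "summit-implies-crux" then
            feedback := feedback.push s!"IGNORED {h.kind} {h.decl}: its axiom closure is not clean ({(h.bad.toList.take 3)}) — a sorried/postulated criterion decides nothing either way"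
        else if h.kind.startsWith "iff-summit-conditional" || h.kind.startsWith "summit-implies-crux-conditional" then
          -- a CONDITIONAL criterion (open hypotheses in its binders): informational under the final-fail policy; the seats decide whether the condition is a proved sibling
          reasons := reasons.push s!"t1a-conditional:{short cr.name}:{h.kind}:{short h.decl}"
          if attacked then
            ambiguity := ambiguity.push s!"converse-conditional:{short cr.name}:{short h.decl}"
            feedback := feedback.push s!"{short cr.name}: {h.decl} is an equivalence/converse with the summit UNDER OPEN HYPOTHESES ({h.kind}) — if those hypotheses are proved siblings this is rule (b) summit-strength; land their `_holds` proofs or expect the seats to rule"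
        else if h.kind != "crux-implies-summit-landed" && h.kind != "crux-implies-summit-conditional" && !(h.kind.startsWith "implies-crux") then
          reasons := reasons.push s!"t1a-info:{short cr.name}:{h.kind}:{short h.decl}"
    unless cr.closed do
      reasons := reasons.push s!"t1:skipped:{short cr.name}"
      if attacked then ambiguity := ambiguity.push s!"crux-not-probed:{short cr.name}"
  -- t1r
  let nAtt := (results.filter fun cr => cr.role == "attacked").size
  let someSImplied := results.any (·.sImpliesC)
  match t1rVerdict with
  | "joint-unassigned" =>
    reasons := reasons.push "t1r:joint-unassigned"
    failGrounds := failGrounds.push "t1r:joint-unassigned"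
    feedback := feedback.push s!"S → C closes for every load-bearing crux ({(lb.toList.map short)}) and no residual is declared: name the attacked conjunct and pass `residual := [the others]`"
  | "joint-declared" =>
    reasons := reasons.push "t1r:joint-declared"
    if nAtt != 1 && inp.mode != "forward" then
      ambiguity := ambiguity.push "split-dispute"
      feedback := feedback.push s!"joint split with {nAtt} attacked conjuncts: exactly one conjunct is attacked, the rest is residual"
  | _ =>
    if results.size ≥ 2 && someSImplied && inp.mode != "forward" then
      ambiguity := ambiguity.push "split-dispute"
      reasons := reasons.push "t1r:partial-joint"
      feedback := feedback.push s!"S → C closes for some but not all load-bearing cruxes ({((results.filter (·.sImpliesC)).toList.map fun cr => short cr.name)}): the split is disputed — the seats decide which conjunct carries the difficulty"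
  -- forward
  if inp.mode == "forward" then
    unless fwOnPath do
      reasons := reasons.push "forward:off-path"
      ambiguity := ambiguity.push "forward-off-path"
      feedback := feedback.push s!"forward: summit → {short lb[0]!} does not close cheaply — the rung is not visibly a special case of the summit; state the rung as an instance/conjunct of S"
    if let some why := fwShape? then
      -- F3: an instantiation / finite truncation of the summit's ∀ is not a rung (it says nothing uniform); exempt only with a genuine transfer theorem
      let rungHeads : List Name := (lb[0]! :: unfoldChain env lb[0]!) ++ (match env.find? lb[0]! with
        | some (.defnInfo di) => (match di.value.getAppFn.constName? with | some h => [h] | none => [])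
        | _ => [])
      let transferOk : Bool := match inp.transfer? with
        | some t => t != (inp.floor?.getD Name.anonymous) && (match env.find? t with
            | some (.thmInfo ti) => ti.type.getUsedConstants.any (fun c => rungHeads.contains c)     -- a theorem ABOUT the rung / its graded family
            | _ => false)
        | none => false
      if transferOk then
        reasons := reasons.push s!"forward:instantiation-exempt:{(inp.transfer?.map short).getD ""}"
      else
        -- POLICY (coordinator 2026-08-18): SHELF, not fail — fixed-index rungs are what ladder rungs are (KPTT k=3, Fermat P_m, Kurihara certificates); the
        -- quantifier shape alone cannot separate "hard theorem at n₀" from "finite check at n₀". Escalate to a FAIL only when the rung is COMPUTATIONAL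
        -- (Type IV): it closes outright by `decide` (its truth is a finite check). A `transfer :=` lemma lifts the shelf.
        let (gd, rD) ← runGoal runner s!"forward:rung-decide" (mkConst lb[0]! ((match env.find? lb[0]! with | some ci => ci.levelParams | none => []).map Level.param)) #["decide"] closesAll (budgetMs := 2 * b.perGoalMs)
        runner := rD
        if gd.closed then
          failGrounds := failGrounds.push "t-fwd:instantiation-computational"
          reasons := reasons.push "t-fwd:instantiation-computational"
          feedback := feedback.push s!"forward: the rung {short lb[0]!} is an instantiation of the summit's leading quantifier ({why}) AND closes by `decide` — a finite computation, not a theorem step (ladder type IV): raise the rung or supply `transfer := <monotonicity/compactness theorem>`"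
        else
          reasons := reasons.push "t-fwd:instantiation"
          ambiguity := ambiguity.push "rung-instantiation"
          feedback := feedback.push s!"forward: the rung {short lb[0]!} is an INSTANTIATION of the summit's leading quantifier ({why}) — frontier shelf, ladder type III/IV-candidate, no summit credit; a `transfer := <monotonicity/compactness theorem>` lifts it"
    if fwRan && !fwRealStep then
      failGrounds := failGrounds.push "forward:same-rung"
      reasons := reasons.push "forward:same-rung"
      feedback := feedback.push s!"forward: the rung {short lb[0]!} is already the floor ({fwSameBy}): the proposed step is not a real step up the ladder — raise the rung"
    unless fwRan do ambiguity := ambiguity.push "forward-unmeasured"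
  -- t3k
  match wi.verdict with
  | "absent" =>
    reasons := reasons.push "t3:absent"; chips := chips.push "t3-plan-only"; ambiguity := ambiguity.push "witness-unverified"
  | "error" =>
    reasons := reasons.push "t3:witness-error"; ambiguity := ambiguity.push "witness-unverified"; feedback := feedback.push s!"witness: {wi.why}"
  | _ =>
    reasons := reasons.push "t3:present"
    if inp.mode != "forward" then
      if !sCaseGiven then
        ambiguity := ambiguity.push "witness-regime-unverified"
        feedback := feedback.push "witness given without `s_case := <the S-restricted case>`: eligibility needs the kernel to see that the restricted case is NOT already provable (witness outside the known regime)"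
      else if sCaseFound then
        ambiguity := ambiguity.push s!"witness-inside-known-regime:{(inp.sCase?.map (·.toString)).getD ""}"
  if sCaseFound then
    reasons := reasons.push "t3:inside-known-regime"
    chips := chips.push "T3-inside-known-regime"
    feedback := feedback.push s!"the S-restricted case {(inp.sCase?.map short).getD ""} is already provable ({sCaseBy}): the witness must sit OUTSIDE the summit's known regime"
  -- t4
  match t4Verdict with
  | "unmatched" =>
    reasons := reasons.push "t4:unmatched"; ambiguity := ambiguity.push "barrier-unmatched"
    feedback := feedback.push s!"method family {famTokens} matches no registered @[method_family] barrier/route: the CLI's docstring match over Literature/Barriers may still place it; else register the family"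
  | "matched" => reasons := reasons.push s!"t4:matched:{matched.size}"
  | _ =>
    reasons := reasons.push "t4:no-family"; ambiguity := ambiguity.push "barrier-unmatched"
  if scanned ≥ cfg.scanCap then ambiguity := ambiguity.push "t1a-scan-capped"
  for r in summitRows do
    if r.status == "empty" then
      reasons := reasons.push s!"summit-empty-carrier:{r.carrier}"
      feedback := feedback.push s!"OPERATOR: the SUMMIT statement quantifies over {trunc r.shown 90}, which is provably EMPTY (`{r.by_}`) — the summit itself is vacuous as typed"
  if ruleDOpen then chips := chips.push (if ruleDExempt then "distinct-conjecture-refutation-first" else "t3-plan-only")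
  chips := (chips.toList.eraseDups).toArray
  ambiguity := (ambiguity.toList.eraseDups).toArray
  failGrounds := (failGrounds.toList.eraseDups).toArray
  let failing := !failGrounds.isEmpty
  let verdict := if failing then "fail"
    else if ambiguity.isEmpty then "eligible"
    else if ruleDExempt then "provisional-frontier"
    else "provisional"
  if !failing && !witnessOk then
    feedback := feedback.push "no kernel witness: pass `witness := <theorem>` (a proved rung of the attacked crux) and `s_case := <the S-restricted case>` (must NOT be provable) to become eligible"
  let finalJ := Json.mkObj [("fail_grounds", strArr failGrounds), ("eligible_blockers", strArr ambiguity),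
    ("kernel_final", failing), ("judge_needed", !failing && !ambiguity.isEmpty)]
  -- lines ---------------------------------------------------------------------------------------------------------------------------------------
  lines := lines.push (s!"#h21_tribunal {inp.rid}  tier {b.tier}  mode {inp.mode}  summit {summitShown}" ++ (match key? with | some k => s!"  key {k}" | none => "") ++
    s!"  cruxes {(lb.toList.map short)}  strong-hyps {shInScope.size}/{shAll.size}  bridges {bridges.size}  scanned {scanned}")
  for cr in results do
    let nm := short cr.name
    lines := lines.push s!"[{nm}] role={cr.role}  t1a {cr.t1aVerdict} {((cr.t1aHits.filter fun h => !(h.kind.startsWith "implies-crux")).toList.map fun h => s!"{h.kind}:{short h.decl}{if h.clean then "" else "(unclean)"}")} {cr.t1aMs}ms"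
    lines := lines.push s!"[{nm}] t1b C→S {cr.cToS.brief} · S→C {cr.sToC.brief}"
    lines := lines.push (s!"[{nm}] t1c {cr.t1cVerdict} tried={cr.t1cTried.size} budget={cr.t1cBudgetMs}ms" ++
      (match cr.t1cCutAfterRank with | some r => s!" cut-after-rank={r}" | none => "") ++ " " ++
      ", ".intercalate ((cr.t1cTried.toList.take 12).map fun h => s!"#{h.rank} {short h.hyp}({h.overlap}):{h.outcome}" ++ (if h.fired then s!" `{h.tactic}` [{h.phase}] bridge={h.bridgeKind}" else "")) ++
      (if cr.t1cTried.size > 12 then s!" … (+{cr.t1cTried.size - 12})" else "") ++ s!" {cr.t1cMs}ms")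
    lines := lines.push s!"[{nm}] t1r {cr.t1r} · t1_kernel {cr.t1Kernel}{match cr.via with | some v => s!" via ({v})" | none => ""} · rule_d_premise {cr.ruleD}"
    lines := lines.push (s!"[{nm}] t-carrier {cr.tcVerdict} " ++ ", ".intercalate ((cr.tcRows.toList.take 8).map fun r => s!"{r.carrier}={r.status}{if r.trivial then "/trivial" else ""}") ++
      (if cr.tcNote.isEmpty then "" else s!" ({cr.tcNote})") ++ s!" {cr.tcMs}ms")
    unless cr.note.isEmpty do lines := lines.push s!"[{nm}] note: {cr.note}"
  lines := lines.push (s!"t3k {wi.verdict}" ++ (match wi.given with | some w => s!" {w} : {trunc wi.type 100}" | none => "") ++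
    (if inp.sCase?.isSome then s!" · s_case found={sCaseFound}" else ""))
  lines := lines.push s!"t4 {t4Verdict} tokens={famTokens} matched={(matchedNames.toList.map short)}"
  if inp.mode == "forward" then
    lines := lines.push s!"forward on_path={fwOnPath} real_step={fwRealStep}{if fwSameBy.isEmpty then "" else s!" ({fwSameBy})"}"
  for n in notes do lines := lines.push s!"note: {n}"
  unless runner.unavailable.isEmpty do lines := lines.push s!"unavailable tactics (no Mathlib?): {runner.unavailable.toList}"
  if runner.uncleanIgnored > 0 then lines := lines.push s!"unclean ignored: {runner.uncleanIgnored} {runner.uncleanSeen.toList}"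
  lines := lines.push s!"VERDICT: {verdict} reasons={reasons.toList}"
  unless failGrounds.isEmpty do lines := lines.push s!"  fail grounds (kernel-final): {failGrounds.toList}"
  unless ambiguity.isEmpty do lines := lines.push s!"  ambiguity: {ambiguity.toList}"
  for f in feedback do lines := lines.push s!"  - {f}"
  let elapsed := (← IO.monoMsNow) - t0
  -- rule (d) seed material for the CLI's `strengthening-top` row
  let strengtheningJ := Json.mkObj [("proved_rungs", nameArr (match wi.given with | some w => if wi.clean then #[w] else #[] | none => #[])),
    ("restriction_parameters", optName inp.sCase?), ("s_case_found", sCaseFound), ("separating", separating)]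
  let j := Json.mkObj [
    ("h21_tribunal", (inp.rid : Json)), ("route", (inp.rid : Json)), ("summit", (summitFq : Json)), ("summit_shown", (summitShown : Json)), ("summit_key", optStr key?),
    ("closes_theorem", optName closesThm?), ("mode", (inp.mode : Json)), ("tier", (b.tier : Json)), ("verdict", (verdict : Json)),
    ("reasons", strArr reasons), ("chips", strArr chips), ("feedback", strArr feedback), ("ambiguity", strArr ambiguity), ("final", finalJ),
    ("cruxes", Json.arr (results.map fun cr => cr.toJson strengtheningJ)),
    ("t1r", Json.mkObj [("verdict", t1rVerdict), ("joint", joint), ("residual", nameArr residualSet), ("load_bearing", nameArr lb)]),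
    ("t3k", Json.mkObj [("verdict", wi.verdict), ("witness", optName wi.given), ("witness_type", wi.type), ("clean", wi.clean), ("why", wi.why),
                        ("witness_mentions_crux", wi.mentionsCrux), ("s_case", sCaseJ)]),
    ("t4", t4J), ("forward", forwardJ), ("tcarrier_summit", summitTcJ),
    ("hard_cores_in_scope", (hcInScope.size : Json)), ("hard_core_hits", Json.arr ((results.foldl (fun acc cr => acc ++ (cr.hcHits.filter fun h => (match h.owner? with | some o => o != inp.rid | none => true)).map fun h => Json.str s!"{short cr.name}:{short h.core}") #[]))),
    ("strong_hypotheses_in_scope", (shInScope.size : Json)), ("strong_hypotheses_visible", (shAll.size : Json)), ("bridges_in_scope", (bridges.size : Json)),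
    ("bridges", Json.arr (bridges.map fun br => Json.mkObj [("decl", br.decl.toString), ("kind", br.kind), ("key", br.key)])),
    ("scanned", (scanned : Json)), ("t1a_ms", (t1aMs : Json)), ("attempts", (runner.attempts : Json)),
    ("index_warm_ms", (match indexWarmMs with | some m => (m : Json) | none => Json.null)), ("unclean_ignored", (runner.uncleanIgnored : Json)), ("unclean_seen", strArr runner.uncleanSeen),
    ("elapsed_ms", (elapsed : Json)), ("options", cfg.toJson), ("budget", b.toJson), ("inputs", inp.toJson),
    ("notes", strArr notes), ("unavailable", strArr runner.unavailable), ("nonce", optStr inp.nonce?), ("v", (1 : Nat))]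
  return (lines, j)

/-! ## The command -/

/-- `#h21_tribunal "route-id" [summit := S] [cruxes := [C, …]] [witness := W] [s_case := X] [residual := [R, …]] [mode := forward|topdown]
[floor := F] [tier := quick|full] [method_family := "tok tok"] [nonce := "hex"]` — see the module doc. `nonce` (or a `"route-id:nonce"` first
argument) is echoed as `"nonce"` in the JSON (marker-injection defence: the consumer takes the marker only from the LAST info message). -/
syntax (name := h21Tribunal) "#h21_tribunal " str
  (ppSpace &"summit" " := " ident)?
  (ppSpace &"cruxes" " := " "[" ident,* "]")?
  (ppSpace &"witness" " := " ident)?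
  (ppSpace &"s_case" " := " ident)?
  (ppSpace &"residual" " := " "[" ident,* "]")?
  (ppSpace &"mode" " := " ident)?
  (ppSpace &"floor" " := " ident)?
  (ppSpace &"transfer" " := " ident)?
  (ppSpace &"tier" " := " ident)?
  (ppSpace &"method_family" " := " str)?
  (ppSpace &"nonce" " := " str)? : command

private def optIdent (stx : Syntax) (i : Nat) : Option Name :=
  if stx[i].isNone then none else some (stx[i][2].getId.replacePrefix `_root_ .anonymous)

private def identList (stx : Syntax) (i : Nat) : Array Name :=
  if stx[i].isNone then #[] else stx[i][3].getSepArgs.map fun x => x.getId.replacePrefix `_root_ .anonymous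

@[command_elab h21Tribunal] def elabH21Tribunal : CommandElab := fun stx => do
  let raw := (stx[1].isStrLit?).getD ""
  -- marker-injection defence (as `#h21_check_closes`): a nonce given as `nonce := "…"` (or as `"<rid>:<nonce>"`) is echoed in the JSON;
  -- the consumer renders a fresh nonce, requires it back, and takes the marker line only from the LAST info message of the file
  let (rid, ridNonce?) : String × Option String := match raw.splitOn ":" with
    | r :: n :: rest => (r, some (":".intercalate (n :: rest)))
    | _ => (raw, none)
  let nonce? : Option String := (if stx[12].isNone then none else stx[12][2].isStrLit?) <|> ridNonce?
  let cfg := Cfg.ofOptions (← getOptions)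
  let res (o : Option Name) : CommandElabM (Option Name) := match o with
    | some n => some <$> resolveName n
    | none => pure none
  let inp : Inputs := {
    rid,
    summit? := (← res (optIdent stx 2)),
    cruxes := (← (identList stx 3).mapM resolveName),
    witness? := (← res (optIdent stx 4)),
    sCase? := (← res (optIdent stx 5)),
    residual := (← (identList stx 6).mapM resolveName),
    mode := (match optIdent stx 7 with | some m => if m.toString == "forward" then "forward" else "topdown" | none => "topdown"),
    floor? := (← res (optIdent stx 8)),
    transfer? := (← res (optIdent stx 9)),
    tier := (match optIdent stx 10 with | some t => if t.toString == "full" then "full" else "quick" | none => "quick"),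
    family := (if stx[11].isNone then "" else (stx[11][2].isStrLit?).getD ""),
    nonce? }
  let saved := (← get).messages
  let savedTrees ← getInfoTrees
  -- the command itself runs WITHOUT a heartbeat cap (every tactic attempt sets its own; their beats accumulate on the global counter)
  let (lines, j) ← try
      liftTermElabM <| withTheReader Core.Context (fun ctx => { ctx with maxHeartbeats := 0 }) (tribunalCore inp cfg)
    catch e =>
      let msg ← e.toMessageData.toString
      pure (errorResult inp (trunc msg 500))
  -- drop whatever the attempts logged (exact? suggestions, aesop warnings) AND the info trees of the hundreds of tactic runs (Mathlib's
  -- `linter.tacticAnalysis` would otherwise re-run them after the command and log `Try this:` warnings at 1:1; they are also large);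
  -- keep earlier messages of the file. The marker line stays the LAST message this command logs.
  modify fun st => { st with messages := saved }
  modifyInfoState fun is => { is with trees := savedTrees }
  logInfo ("\n".intercalate lines.toList ++ "\n" ++ marker ++ " " ++ j.compress)

end HarnessLib.Audit.Tribunal
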